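import Literature.Barriers.ABC.UniformABCDiscriminantSharpProofs
import HarnessLib

/-!
# Masser's theorem `UniformABCDiscriminantSharp` in every degree (prime base degree; discharge)

Second sibling proof file for `Literature/Barriers/ABC/UniformABCDiscriminantSharp.lean`
[cite: Masser2002, Theorem and §3] (D. W. Masser, *On abc and discriminants*, Proc. Amer. Math.
Soc. 130 (2002) 3141–3150; read in full), continuing
`Literature/Barriers/ABC/UniformABCDiscriminantSharpProofs.lean` (base degrees `2` and `3`; that
file's remark that the degrees coprime to `6` "would require Faltings" is superseded here). Kept
in a separate module only because of the proposal size cap.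

## Main results

* `UniformABCDiscriminantSharp_holds : UniformABCDiscriminantSharp` — the named fact, discharged
  (every `n ≥ 2`, `λ ≥ 1`, `ν < 1/(λn+1)`, `C`), via `uniformABCDiscriminantSharp_all`:
  even `n` by `uniformABCDiscriminantSharp_even` (base degree `2`, sibling file), odd `n` by
* `uniformABCDiscriminantSharp_prime_dvd`: every `n` divisible by a prime `p ≥ 3`, base degree `p`.

## The argument, and where it deviates from Masser's

Masser (§3) takes `ξ` a root of `F = X^n − n ũ^{(n−1)f} X + (n−1) u^{nf}` for a pigeonholed pair
of smooth numbers `u ≡ ũ (mod 2^d)` and needs `[ℚ(ξ):ℚ] = n`, i.e. irreducibility of `F`, which he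
obtains (§2, Proposition) from Hilbert irreducibility proved via Faltings' theorem, with an
ineffective exceptional set. Here the construction is run in a *prime* base degree `p ∣ n`
(`f = 1`, squareful modulus `M² ∣ ũ − u` with `M = m^{⌊d/2⌋}` for a Bertrand prime `m ∈ (Y, 2Y]`),
followed by the base change `K ↦ L = K(r^{1/e})`, `n = pe` (`r` a small odd prime unramified in
`K`; `BaseChangeField` of the sibling file), computing `H_L`, `S_L`, `D_L` directly in `L`
(`exists_masserTriple`, `natAbs_discr_baseChangeField_le`). Irreducibility is replaced by
`irreducible_or_exists_root`: the smooth numbers are built only from primes `ℓ ≡ g (mod p)` with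
`g` a generator of `(ℤ/p)^×` (`primesModEq`); for such a prime `ℓ ∣ ũ` (`ℓ > p`, `ℓ ∤ u`) one has
`F ≡ X^p − b^p = (X − b) Ψ_b (mod ℓ)` with `Ψ_b = (X^p − b^p)/(X − b)` irreducible over `𝔽_ℓ`
(`irreducible_psiPoly`: a root of an irreducible factor of degree `f` gives an element of order
`p` in `𝔽_{ℓ^f}^×`, so `(ℓ mod p)^f = 1` and `p − 1 ∣ f`); hence every factorisation of the monic
`F` over `ℤ` has a linear factor: `F` is irreducible over `ℚ` or has an integer root, and in the
latter case the same triple lies in `ℚ` and the field `ℚ(2^{1/n})` works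
(`exists_field_prime_core`). The only analytic input beyond Chebyshev's bound
(`Chebyshev.theta_ge`, through `eventually_theta_ge_half`) is Dirichlet's theorem in Mathlib's
form `ArithmeticFunction.vonMangoldt.not_summable_residueClass_prime_div` (divergence of
`Σ_{ℓ ≡ g} log ℓ / ℓ`), which yields `#{ℓ ≤ Y : ℓ ≡ g (p)} ≥ Y^c` for every `c < 1` along a
sequence `Y → ∞` (`exists_card_primesModEq_ge`): since `ν < 1/(λp+1)` leaves slack, this
suffices where Masser's Lemma (at the exact exponent `η = 1/(λn+1)`) uses second-order prime
counting. The discriminant saving uses the explicit integral element `ω = (ξ − u) G(ξ)/M`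
(`F_u = (X − u)² G`, `ω² ∈ ℤ[ξ]`; `primeOmega`, `isIntegral_primeOmega`) instead of Hensel's
bound in (3.9), and `disc(1, ξ, …, ξ^{p−1}) = ± p^p (p−1)^{p−1} (u^{p(p−1)} − ũ^{p(p−1)})`
(`discr_powerBasis_primeRoot`) is computed from `N(ξ − t) = (−1)^p F(t)` and
`ξ (ξ^{p−1} − ũ^{p−1}) = (p − 1)(ũ^{p−1} ξ − u^p)`.

## Contents (all proved; the `def`s are auxiliary polynomials/fields/sets/matrices, no `Prop` facts)

* `psiPoly`, `irreducible_psiPoly`; `masserPolyZ`, `exists_pow_eq_of_not_dvd`,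
  `irreducible_or_exists_root`.
* `masserA`/`masserB`/`masserPoly`, `MasserPrimeField p u v = ℚ[X]/(X^p − p v^{p−1} X + (p−1) u^p)`,
  `norm_primeRoot_sub`, `norm_primeRoot_pow_sub`, `norm_derivative_primeRoot`,
  `discr_powerBasis_primeRoot`.
* `degenPolyZ`, `degenQuotZ`, `thetaPolyZ`, `primeTheta`, `primeOmega`, `isIntegral_primeOmega`;
  `masserH`, `primeChange` (`det = 1/M`), `primeFamily`, `primeBasis`, `discr_primeFamily`,
  `abs_discr_masserPrimeField_le` (`|D_K| ≤ h_p |k|`, `D_K ∣ h_p k`, `k = (v^N − u^N)/M²`).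
* `exists_masserTriple_prime`, `exists_field_prime_core` (degree `pe`, both cases).
* `rad_masserAB_le`, `log_discr_bound_eqP`, `prime_final_step`, `primesModEq`,
  `coprime_masserA_masserB`, `prime_assembly`.
* `log_div_self_le_rpow`, `exists_card_primesModEq_ge` (Dirichlet, counting form along a
  subsequence); `exists_slackP`, `isLittleO_rpow_main'`, `isLittleO_errorFun'`, `prime_need_arith`,
  `param_boundsP`, `exists_good_params_prime`.
* `uniformABCDiscriminantSharp_prime_dvd`, `uniformABCDiscriminantSharp_all`,
  `UniformABCDiscriminantSharp_holds`.
-/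

noncomputable section

namespace Literature.Barriers.ABC

open NumberField IsDedekindDomain Height

/-! ### Irreducibility of `(X^p − b^p)/(X − b)` over `𝔽_ℓ` when `ℓ` is a primitive root mod `p` -/

section PrimRootIrred

open Polynomial Finset

variable {ℓ : ℕ} [hℓ : Fact ℓ.Prime]

/-- `Ψ_b(X) = Σ_{i<p} X^i b^{p-1-i} = (X^p − b^p)/(X − b)` over `𝔽_ℓ`. [folklore] -/
def psiPoly (p : ℕ) (b : ZMod ℓ) : (ZMod ℓ)[X] :=
  ∑ i ∈ Finset.range p, X ^ i * C (b ^ (p - 1 - i))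

/-- `Ψ_b(X) · (X − b) = X^p − b^p`. [folklore] -/
theorem psiPoly_mul (p : ℕ) (b : ZMod ℓ) :
    psiPoly p b * (X - C b) = X ^ p - C (b ^ p) := by
  unfold psiPoly
  have h := (Commute.all (X : (ZMod ℓ)[X]) (C b)).geom_sum₂_mul p
  simp only [← C_pow] at h ⊢
  convert h using 2

/-- `Ψ_b(b) = p b^{p-1}`. [folklore] -/
theorem psiPoly_eval_self (p : ℕ) (b : ZMod ℓ) :
    (psiPoly p b).eval b = (p : ZMod ℓ) * b ^ (p - 1) := by
  unfold psiPoly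
  rw [eval_finsetSum]
  have : ∀ i ∈ Finset.range p, ((X : (ZMod ℓ)[X]) ^ i * C (b ^ (p - 1 - i))).eval b = b ^ (p - 1) := by
    intro i hi
    rw [eval_mul, eval_pow, eval_X, eval_C, ← pow_add]
    congr 1
    have := Finset.mem_range.mp hi
    omega
  rw [Finset.sum_congr rfl this, Finset.sum_const, Finset.card_range, nsmul_eq_mul]

/-- `Ψ_b` is monic of degree `p − 1` (for `p ≥ 1`). [folklore] -/
theorem psiPoly_monic {p : ℕ} (hp : 1 ≤ p) (b : ZMod ℓ) :
    (psiPoly p b).Monic ∧ (psiPoly p b).natDegree = p - 1 := by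
  have hmul := psiPoly_mul p b
  have hXb : (X - C b : (ZMod ℓ)[X]).Monic := monic_X_sub_C b
  have hrhs : (X ^ p - C (b ^ p) : (ZMod ℓ)[X]).Monic := monic_X_pow_sub_C _ (by omega)
  have hmon : (psiPoly p b).Monic := by
    apply Monic.of_mul_monic_right hXb
    rw [hmul]; exact hrhs
  refine ⟨hmon, ?_⟩
  have hdeg := congrArg natDegree hmul
  rw [hmon.natDegree_mul hXb, natDegree_X_sub_C, natDegree_X_pow_sub_C] at hdeg
  omega

/-- **Irreducibility of `Ψ_b` over `𝔽_ℓ`** when `p` is prime, `ℓ ≠ p`, `b ≠ 0` and the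
multiplicative order of `ℓ` mod `p` is `p − 1`: a root `η` of an irreducible factor of degree `f`
gives `ζ = η/b` of order `p` in `𝔽_{ℓ^f}^×`, so `p ∣ ℓ^f − 1`, forcing `f = p − 1`. [folklore] -/
theorem irreducible_psiPoly {p : ℕ} (hp : p.Prime) (hℓp : ℓ ≠ p) {b : ZMod ℓ} (hb : b ≠ 0)
    (hord : ∀ f : ℕ, 0 < f → ((ℓ : ZMod p)) ^ f = 1 → p - 1 ≤ f) :
    Irreducible (psiPoly p b) := by
  classical
  haveI : Fact p.Prime := ⟨hp⟩
  obtain ⟨hmon, hdeg⟩ := psiPoly_monic hp.one_lt.le b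
  have hdegpos : 0 < (psiPoly p b).degree := by
    rw [degree_eq_natDegree hmon.ne_zero, hdeg]
    have := hp.two_le
    exact_mod_cast (show 0 < p - 1 by omega)
  obtain ⟨P₀, hP₀irr, hP₀dvd⟩ := exists_irreducible_of_degree_pos hdegpos
  -- normalise the irreducible factor to be monic
  have hP₀0 : P₀ ≠ 0 := hP₀irr.ne_zero
  set P := P₀ * C (P₀.leadingCoeff)⁻¹ with hPdef
  have hPmon : P.Monic := monic_mul_leadingCoeff_inv hP₀0
  have hunit : IsUnit (C (P₀.leadingCoeff)⁻¹) :=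
    isUnit_C.mpr (IsUnit.inv (isUnit_iff_ne_zero.mpr (leadingCoeff_ne_zero.mpr hP₀0)))
  have hPirr : Irreducible P := (irreducible_mul_isUnit hunit).mpr hP₀irr
  have hPdvd : P ∣ psiPoly p b := (hunit.mul_right_dvd).mpr hP₀dvd
  haveI hPfact : Fact (Irreducible P) := ⟨hPirr⟩
  -- the field `𝔽 = 𝔽_ℓ[X]/(P)` of cardinality `ℓ^f`
  set f := P.natDegree with hfdef
  have hfpos : 0 < f := natDegree_pos_iff_degree_pos.mpr (degree_pos_of_irreducible hPirr)
  have hP0 : P ≠ 0 := hPirr.ne_zero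
  let pb := AdjoinRoot.powerBasis hP0
  haveI : Module.Finite (ZMod ℓ) (AdjoinRoot P) := pb.finite
  haveI : Finite (AdjoinRoot P) := Module.finite_of_finite (ZMod ℓ)
  letI : Fintype (AdjoinRoot P) := Fintype.ofFinite _
  have hcard : Fintype.card (AdjoinRoot P) = ℓ ^ f := by
    rw [Module.card_eq_pow_finrank (K := ZMod ℓ), ZMod.card, pb.finrank, AdjoinRoot.powerBasis_dim]
  -- the root `η` and `ζ = η / b`
  set η : AdjoinRoot P := AdjoinRoot.root P with hηdef
  have hηP : aeval η P = 0 := by rw [hηdef, AdjoinRoot.aeval_eq, AdjoinRoot.mk_self]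
  have hηpsi : aeval η (psiPoly p b) = 0 := by
    obtain ⟨Q, hQ⟩ := hPdvd
    rw [hQ, map_mul, hηP, zero_mul]
  have hηpow : η ^ p = (algebraMap (ZMod ℓ) (AdjoinRoot P) b) ^ p := by
    have h := congrArg (aeval η) (psiPoly_mul p b)
    rw [map_mul, hηpsi, zero_mul, map_sub, aeval_X_pow, aeval_C, map_pow] at h
    exact (sub_eq_zero.mp h.symm)
  set bb : AdjoinRoot P := algebraMap (ZMod ℓ) (AdjoinRoot P) b with hbbdef
  have hbb0 : bb ≠ 0 := by
    rw [hbbdef]; exact (map_ne_zero_iff _ (algebraMap (ZMod ℓ) (AdjoinRoot P)).injective).mpr hb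
  have hηne : η ≠ bb := by
    intro hηb
    -- then `Ψ_b(b) = 0`, i.e. `p b^{p-1} = 0` in `𝔽_ℓ`
    have h1 : aeval bb (psiPoly p b) = 0 := by rw [← hηb]; exact hηpsi
    rw [hbbdef, aeval_algebraMap_apply,
      map_eq_zero_iff _ (algebraMap (ZMod ℓ) (AdjoinRoot P)).injective,
      coe_aeval_eq_eval, psiPoly_eval_self] at h1
    rcases mul_eq_zero.mp h1 with h2 | h2
    · rw [ZMod.natCast_eq_zero_iff] at h2
      exact hℓp ((Nat.prime_dvd_prime_iff_eq hℓ.out hp).mp h2)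
    · exact hb (pow_eq_zero_iff (by have := hp.two_le; omega) |>.mp h2)
  set ζ : AdjoinRoot P := η * bb⁻¹ with hζdef
  have hζp : ζ ^ p = 1 := by
    rw [hζdef, mul_pow, hηpow, inv_pow, mul_inv_cancel₀ (pow_ne_zero _ hbb0)]
  have hζ1 : ζ ≠ 1 := by
    intro h1
    apply hηne
    rw [hζdef, mul_inv_eq_one₀ hbb0] at h1
    exact h1
  have hζ0 : ζ ≠ 0 := by
    intro h0; rw [h0, zero_pow hp.ne_zero] at hζp; exact zero_ne_one hζp
  have hordζ : orderOf ζ = p := orderOf_eq_prime hζp hζ1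
  -- `p ∣ ℓ^f − 1`
  have hdvd : p ∣ ℓ ^ f - 1 := by
    have h1 : orderOf (Units.mk0 ζ hζ0) ∣ Fintype.card (AdjoinRoot P)ˣ := orderOf_dvd_card
    rw [← orderOf_units, Units.val_mk0, hordζ, Fintype.card_units, hcard] at h1
    exact h1
  -- hence `(ℓ : ZMod p)^f = 1`, so `p − 1 ≤ f`
  have hpow1 : ((ℓ : ZMod p)) ^ f = 1 := by
    have h1 : ((ℓ ^ f - 1 : ℕ) : ZMod p) = 0 := (ZMod.natCast_eq_zero_iff _ _).mpr hdvd
    have h2 : 1 ≤ ℓ ^ f := Nat.one_le_pow _ _ hℓ.out.pos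
    rw [Nat.cast_sub h2, Nat.cast_pow, Nat.cast_one, sub_eq_zero] at h1
    exact h1
  have hfge : p - 1 ≤ f := hord f hfpos hpow1
  -- and `f ≤ p − 1 = deg Ψ_b`, so `P = Ψ_b`
  have hfle : f ≤ p - 1 := by
    rw [hfdef, ← hdeg]
    exact natDegree_le_of_dvd hPdvd hmon.ne_zero
  have hPeq : psiPoly p b = P :=
    eq_of_monic_of_dvd_of_natDegree_le hPmon hmon hPdvd (by rw [hdeg]; exact le_trans hfge le_rfl)
  rw [hPeq]
  exact hPirr

end PrimRootIrred

/-! ### Masser's trinomial in prime degree: irreducible, or an integer root -/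

section TrinomialDichotomy

open Polynomial

/-- Masser's trinomial `X^p − A X + B` over `ℤ`. [cite: Masser2002, §3 (3.6)] -/
def masserPolyZ (p : ℕ) (A B : ℤ) : ℤ[X] := X ^ p - C A * X + C B

/-- `X^p − AX + B = X^p + (B − AX)` with the second summand of degree `< p` (for `p ≥ 2`).
[folklore] -/
theorem masserPolyZ_eq_add {p : ℕ} (hp : 2 ≤ p) (A B : ℤ) :
    masserPolyZ p A B = X ^ p + (C B - C A * X) ∧ (C B - C A * X : ℤ[X]).degree < (X ^ p : ℤ[X]).degree := by
  refine ⟨by unfold masserPolyZ; ring, ?_⟩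
  rw [degree_X_pow]
  calc (C B - C A * X : ℤ[X]).degree ≤ max (C B).degree (C A * X : ℤ[X]).degree := degree_sub_le _ _
    _ ≤ max 0 1 := by
        apply max_le_max degree_C_le
        exact le_trans (degree_mul_le _ _) (le_trans (add_le_add degree_C_le degree_X_le) (by norm_num))
    _ < (p : WithBot ℕ) := by
        rw [max_eq_right (by norm_num)]
        exact_mod_cast hp

/-- Monic (for `p ≥ 2`). [folklore] -/
theorem masserPolyZ_monic {p : ℕ} (hp : 2 ≤ p) (A B : ℤ) : (masserPolyZ p A B).Monic := by
  obtain ⟨h1, h2⟩ := masserPolyZ_eq_add hp A B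
  rw [h1]
  exact (monic_X_pow p).add_of_left h2

/-- Degree `p` (for `p ≥ 2`). [folklore] -/
theorem masserPolyZ_natDegree {p : ℕ} (hp : 2 ≤ p) (A B : ℤ) : (masserPolyZ p A B).natDegree = p := by
  obtain ⟨h1, h2⟩ := masserPolyZ_eq_add hp A B
  rw [h1, natDegree_add_eq_left_of_degree_lt h2, natDegree_X_pow]

/-- Evaluation. [folklore] -/
theorem masserPolyZ_eval (p : ℕ) (A B t : ℤ) : (masserPolyZ p A B).eval t = t ^ p - A * t + B := by
  simp [masserPolyZ]

/-- In `𝔽_ℓ` every element is a `p`-th power when `p` is a prime not dividing `ℓ − 1`. [folklore] -/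
theorem exists_pow_eq_of_not_dvd {ℓ p : ℕ} [hℓ : Fact ℓ.Prime] (hp : p.Prime) (hpl : ¬ p ∣ ℓ - 1)
    (a : ZMod ℓ) : ∃ b : ZMod ℓ, b ^ p = a := by
  by_cases ha : a = 0
  · exact ⟨0, by rw [ha, zero_pow hp.ne_zero]⟩
  · have hcard : Nat.card (ZMod ℓ)ˣ = ℓ - 1 := by
      rw [Nat.card_eq_fintype_card, ZMod.card_units]
    have hcop : (Nat.card (ZMod ℓ)ˣ).Coprime p := by
      rw [hcard]
      exact ((Nat.Prime.coprime_iff_not_dvd hp).mpr hpl).symm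
    set u : (ZMod ℓ)ˣ := Units.mk0 a ha with hu
    refine ⟨((powCoprime hcop).symm u : (ZMod ℓ)ˣ), ?_⟩
    have h1 : powCoprime hcop ((powCoprime hcop).symm u) = u := Equiv.apply_symm_apply _ _
    rw [powCoprime_apply] at h1
    have h2 := congrArg (fun x : (ZMod ℓ)ˣ => (x : ZMod ℓ)) h1
    simpa [hu] using h2

/-- **Irreducible, or an integer root.** Let `p ≥ 3` be prime and `F = X^p − AX + B ∈ ℤ[X]`.
If a prime `ℓ ≠ p` divides `A` but not `B` and the order of `ℓ` mod `p` is `p − 1`, then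
`F mod ℓ = X^p − b^p = (X − b) Ψ_b(X)` with `Ψ_b` irreducible of degree `p − 1`, so every monic
factorisation of `F` over `ℤ` has a linear factor: `F` is irreducible over `ℚ` or has an integer
root. (This replaces Masser's use of Hilbert irreducibility via Faltings' theorem,
[cite: Masser2002, §2 Proposition], for the degenerate trinomial.) [folklore] -/
theorem irreducible_or_exists_root {p : ℕ} (hp : p.Prime) (hp3 : 3 ≤ p) {A B : ℤ} {ℓ : ℕ}
    (hℓ : ℓ.Prime) (hℓp : ℓ ≠ p) (hA : (ℓ : ℤ) ∣ A) (hB : ¬ (ℓ : ℤ) ∣ B)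
    (hord : ∀ f : ℕ, 0 < f → ((ℓ : ZMod p)) ^ f = 1 → p - 1 ≤ f) :
    Irreducible ((masserPolyZ p A B).map (algebraMap ℤ ℚ)) ∨
      ∃ t : ℤ, (masserPolyZ p A B).eval t = 0 := by
  classical
  haveI : Fact ℓ.Prime := ⟨hℓ⟩
  have hp2 : 2 ≤ p := by omega
  set F := masserPolyZ p A B with hFdef
  have hFmon : F.Monic := masserPolyZ_monic hp2 A B
  have hFdeg : F.natDegree = p := masserPolyZ_natDegree hp2 A B
  by_cases hirr : Irreducible F
  · left
    exact (hFmon.irreducible_iff_irreducible_map_fraction_map (K := ℚ)).mp hirr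
  right
  -- `p ∤ ℓ − 1`
  have hpl : ¬ p ∣ ℓ - 1 := by
    intro hdvd
    have h1 : ((ℓ - 1 : ℕ) : ZMod p) = 0 := (ZMod.natCast_eq_zero_iff _ _).mpr hdvd
    have h2 : ((ℓ : ZMod p)) ^ 1 = 1 := by
      rw [pow_one]
      rw [Nat.cast_sub hℓ.one_lt.le, Nat.cast_one, sub_eq_zero] at h1
      exact h1
    have := hord 1 one_pos h2
    omega
  -- a nontrivial monic factorisation `F = f g`
  have hF1 : F ≠ 1 := by
    intro h1
    have := congrArg natDegree h1
    rw [hFdeg, natDegree_one] at this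
    omega
  rw [hFmon.irreducible_iff_natDegree] at hirr
  push Not at hirr
  obtain ⟨f, g, hf, hg, hfg, hf0, hg0⟩ := hirr hF1
  -- reduction mod `ℓ`: `F mod ℓ = X^p − b^p = Ψ_b (X − b)`
  set π := Int.castRingHom (ZMod ℓ) with hπ
  have hAπ : (A : ZMod ℓ) = 0 := (ZMod.intCast_zmod_eq_zero_iff_dvd A ℓ).mpr hA
  have hBπ : (B : ZMod ℓ) ≠ 0 := fun h => hB ((ZMod.intCast_zmod_eq_zero_iff_dvd B ℓ).mp h)
  obtain ⟨b, hb⟩ := exists_pow_eq_of_not_dvd hp hpl (-(B : ZMod ℓ))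
  have hb0 : b ≠ 0 := by
    intro h0
    rw [h0, zero_pow hp.ne_zero] at hb
    exact hBπ (neg_eq_zero.mp hb.symm)
  have hFmap : F.map π = psiPoly p b * (X - C b) := by
    rw [psiPoly_mul, hb, hFdef]
    unfold masserPolyZ
    rw [Polynomial.map_add, Polynomial.map_sub, Polynomial.map_pow, Polynomial.map_mul, map_X,
      map_C, map_C, hπ, eq_intCast, eq_intCast, hAπ, C_0, zero_mul, sub_zero, C_neg]
    ring
  have hprime : Prime (psiPoly p b) := (irreducible_psiPoly hp hℓp hb0 hord).prime
  obtain ⟨-, hpsideg⟩ := psiPoly_monic (ℓ := ℓ) hp.one_lt.le b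
  -- the key step: whichever factor `Ψ_b` divides, the other one is linear
  have key : ∀ f g : ℤ[X], f.Monic → g.Monic → f * g = F → g.natDegree ≠ 0 →
      psiPoly p b ∣ f.map π → ∃ t : ℤ, F.eval t = 0 := by
    intro f g hf hg hfg hg0 hdvd
    have hsum : f.natDegree + g.natDegree = p := by
      rw [← hf.natDegree_mul hg, hfg, hFdeg]
    have hfdeg : p - 1 ≤ f.natDegree := by
      have h1 := natDegree_le_of_dvd hdvd (hf.map π).ne_zero
      rwa [hpsideg, hf.natDegree_map] at h1
    have hg1 : g.natDegree = 1 := by omega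
    have hgX : g = X + C (g.coeff 0) := hg.eq_X_add_C hg1
    refine ⟨-g.coeff 0, ?_⟩
    rw [← hfg, eval_mul, hgX]
    simp
  have hdvd : psiPoly p b ∣ f.map π * g.map π := by
    rw [← Polynomial.map_mul, hfg, hFmap]
    exact dvd_mul_right _ _
  rcases hprime.dvd_or_dvd hdvd with h | h
  · exact key f g hf hg hfg hg0 h
  · exact key g f hg hf (by rw [mul_comm]; exact hfg) hf0 h

end TrinomialDichotomy

/-! ### The base field `K = ℚ(ξ)`, `ξ^p = p v^{p-1} ξ − (p−1) u^p` (Masser's trinomial, any `p ≥ 2`) -/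

section PrimeField

open Polynomial

/-- `A = p v^{p-1}`. [cite: Masser2002, §3 (3.6)] -/
def masserA (p v : ℕ) : ℕ := p * v ^ (p - 1)

/-- `B = (p − 1) u^p`. [cite: Masser2002, §3 (3.6)] -/
def masserB (p u : ℕ) : ℕ := (p - 1) * u ^ p

/-- Masser's trinomial `X^p − p v^{p-1} X + (p−1) u^p` over `ℚ`. [cite: Masser2002, §3 (3.6)] -/
def masserPoly (p u v : ℕ) : ℚ[X] := X ^ p - C (masserA p v : ℚ) * X + C (masserB p u : ℚ)

/-- `masserPoly` is the base change of `masserPolyZ`. [folklore] -/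
theorem masserPoly_eq_map (p u v : ℕ) :
    masserPoly p u v = (masserPolyZ p (masserA p v) (masserB p u)).map (algebraMap ℤ ℚ) := by
  unfold masserPoly masserPolyZ
  simp [Polynomial.map_sub, Polynomial.map_mul]

/-- Monic. [folklore] -/
theorem masserPoly_monic {p : ℕ} (hp : 2 ≤ p) (u v : ℕ) : (masserPoly p u v).Monic := by
  rw [masserPoly_eq_map]; exact (masserPolyZ_monic hp _ _).map _

/-- Degree `p`. [folklore] -/
theorem masserPoly_natDegree {p : ℕ} (hp : 2 ≤ p) (u v : ℕ) : (masserPoly p u v).natDegree = p := by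
  rw [masserPoly_eq_map, (masserPolyZ_monic hp _ _).natDegree_map, masserPolyZ_natDegree hp]

/-- Nonzero. [folklore] -/
theorem masserPoly_ne_zero {p : ℕ} (hp : 2 ≤ p) (u v : ℕ) : masserPoly p u v ≠ 0 :=
  (masserPoly_monic hp u v).ne_zero

/-- Evaluation. [folklore] -/
theorem masserPoly_eval (p u v : ℕ) (t : ℚ) :
    (masserPoly p u v).eval t = t ^ p - (masserA p v : ℚ) * t + (masserB p u : ℚ) := by
  simp [masserPoly]

/-- The field `K = ℚ[X]/(X^p − p v^{p-1} X + (p−1) u^p)`. [cite: Masser2002, §3 (3.6)] -/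
abbrev MasserPrimeField (p u v : ℕ) : Type := AdjoinRoot (masserPoly p u v)

variable {p u v : ℕ} [hirrp : Fact (Irreducible (masserPoly p u v))]

/-- The root `ξ`. [folklore] -/
abbrev primeRoot (p u v : ℕ) : MasserPrimeField p u v := AdjoinRoot.root (masserPoly p u v)

/-- `ξ` is a root. [folklore] -/
theorem aeval_primeRoot : aeval (primeRoot p u v) (masserPoly p u v) = 0 := by
  have h := AdjoinRoot.mk_self (f := masserPoly p u v)
  rw [← AdjoinRoot.aeval_eq] at h
  exact h

omit hirrp in
/-- `aeval` of Masser's trinomial. [folklore] -/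
theorem aeval_masserPoly {R : Type*} [CommRing R] [Algebra ℚ R] (x : R) :
    aeval x (masserPoly p u v) = x ^ p - (masserA p v : R) * x + (masserB p u : R) := by
  simp [masserPoly]

/-- `ξ^p = A ξ − B`. [folklore] -/
theorem primeRoot_pow :
    (primeRoot p u v) ^ p = (masserA p v : MasserPrimeField p u v) * primeRoot p u v -
      (masserB p u : MasserPrimeField p u v) := by
  have h := aeval_primeRoot (p := p) (u := u) (v := v)
  rw [aeval_masserPoly] at h
  linear_combination h

/-- `ξ` is an algebraic integer. [folklore] -/
theorem isIntegral_primeRoot (hp : 2 ≤ p) : IsIntegral ℤ (primeRoot p u v) := by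
  refine ⟨masserPolyZ p (masserA p v) (masserB p u), masserPolyZ_monic hp _ _, ?_⟩
  have h : aeval (primeRoot p u v)
      ((masserPolyZ p (masserA p v) (masserB p u)).map (algebraMap ℤ ℚ)) = 0 := by
    rw [← masserPoly_eq_map]; exact aeval_primeRoot
  rw [aeval_map_algebraMap] at h
  rwa [← aeval_def]

/-- `ξ` as an element of `𝓞 K`. [folklore] -/
def primeRootInt (hp : 2 ≤ p) : 𝓞 (MasserPrimeField p u v) := ⟨primeRoot p u v, isIntegral_primeRoot hp⟩

/-- `minpoly_ℚ(ξ) = masserPoly`. [folklore] -/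
theorem minpoly_primeRoot (hp : 2 ≤ p) : minpoly ℚ (primeRoot p u v) = masserPoly p u v := by
  have h := AdjoinRoot.minpoly_powerBasis_gen_of_monic (K := ℚ) (masserPoly_monic hp u v)
    (hirrp.out.ne_zero)
  rwa [AdjoinRoot.powerBasis_gen] at h

/-- `[K:ℚ] = p`. [folklore] -/
theorem finrank_masserPrimeField (hp : 2 ≤ p) : Module.finrank ℚ (MasserPrimeField p u v) = p := by
  rw [PowerBasis.finrank (AdjoinRoot.powerBasis (masserPoly_ne_zero hp u v)),
    AdjoinRoot.powerBasis_dim, masserPoly_natDegree hp]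

/-- `N_{K/ℚ}(ξ − t) = (−1)^p F(t)` for rational `t`. [folklore] -/
theorem norm_primeRoot_sub (hp : 2 ≤ p) (t : ℚ) :
    Algebra.norm ℚ (primeRoot p u v - algebraMap ℚ _ t) = (-1) ^ p * (masserPoly p u v).eval t := by
  have hξ : IsIntegral ℚ (primeRoot p u v) := (isIntegral_primeRoot (u := u) (v := v) hp).tower_top
  have hx : IsIntegral ℚ (primeRoot p u v - algebraMap ℚ _ t) := hξ.sub isIntegral_algebraMap
  have hadj : Algebra.adjoin ℚ {primeRoot p u v - algebraMap ℚ (MasserPrimeField p u v) t} = ⊤ := by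
    apply PowerBasis.adjoin_eq_top_of_gen_mem_adjoin
      (B := AdjoinRoot.powerBasis (masserPoly_ne_zero hp u v))
    rw [AdjoinRoot.powerBasis_gen]
    have hmem : (primeRoot p u v - algebraMap ℚ (MasserPrimeField p u v) t) +
        algebraMap ℚ (MasserPrimeField p u v) t ∈
        Algebra.adjoin ℚ {primeRoot p u v - algebraMap ℚ (MasserPrimeField p u v) t} :=
      Subalgebra.add_mem _ (Algebra.self_mem_adjoin_singleton ℚ _) (Subalgebra.algebraMap_mem _ t)
    rw [sub_add_cancel] at hmem
    exact hmem
  have h := Algebra.PowerBasis.norm_gen_eq_coeff_zero_minpoly (PowerBasis.ofAdjoinEqTop hx hadj)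
  rw [PowerBasis.ofAdjoinEqTop_gen, PowerBasis.ofAdjoinEqTop_dim, minpoly.sub_algebraMap,
    minpoly_primeRoot hp] at h
  rw [h, natDegree_comp, masserPoly_natDegree hp, natDegree_X_add_C, mul_one,
    coeff_zero_eq_eval_zero, eval_comp, eval_add, eval_X, eval_C, zero_add]

/-- `N_{K/ℚ}(ξ) = (−1)^p B`. [folklore] -/
theorem norm_primeRoot (hp : 2 ≤ p) :
    Algebra.norm ℚ (primeRoot p u v) = (-1) ^ p * (masserB p u : ℚ) := by
  have h := norm_primeRoot_sub (p := p) (u := u) (v := v) hp 0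
  rw [map_zero, sub_zero] at h
  rw [h, masserPoly_eval]
  simp [zero_pow (show p ≠ 0 by omega)]

/-- The key identity `ξ (ξ^{p-1} − v^{p-1}) = (p − 1)(v^{p-1} ξ − u^p)`. [cite: Masser2002, §3 (3.9)] -/
theorem primeRoot_mul_sub (hp : 2 ≤ p) :
    primeRoot p u v * ((primeRoot p u v) ^ (p - 1) - algebraMap ℚ _ ((v : ℚ) ^ (p - 1))) =
      algebraMap ℚ _ ((p : ℚ) - 1) *
        (algebraMap ℚ _ ((v : ℚ) ^ (p - 1)) * primeRoot p u v - algebraMap ℚ _ ((u : ℚ) ^ p)) := by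
  have h := primeRoot_pow (p := p) (u := u) (v := v)
  have hpow : primeRoot p u v * (primeRoot p u v) ^ (p - 1) = (primeRoot p u v) ^ p := by
    rw [← pow_succ']; congr 1; omega
  have hA : (masserA p v : MasserPrimeField p u v) = (p : MasserPrimeField p u v) *
      (v : MasserPrimeField p u v) ^ (p - 1) := by simp [masserA]
  have hB : (masserB p u : MasserPrimeField p u v) = ((p : MasserPrimeField p u v) - 1) *
      (u : MasserPrimeField p u v) ^ p := by
    simp only [masserB, Nat.cast_mul, Nat.cast_pow, Nat.cast_sub (show 1 ≤ p by omega), Nat.cast_one]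
  rw [hA, hB] at h
  rw [mul_sub, hpow, h]
  simp only [map_sub, map_one, map_natCast, map_pow]
  ring

/-- Pure field arithmetic behind `norm_primeRoot_pow_sub`. [folklore] -/
private theorem norm_pow_sub_aux {p : ℕ} (hp : 2 ≤ p) {P α β N : ℚ} (hα : α ≠ 0) (hβ : β ≠ 0)
    (hP : P - 1 ≠ 0)
    (hkey : (-1) ^ p * ((P - 1) * β) * N =
      (P - 1) ^ p * (α ^ p * ((-1) ^ p * ((β / α) ^ p - P * α * (β / α) + (P - 1) * β)))) :
    N = (P - 1) ^ (p - 1) * (β ^ (p - 1) - α ^ p) := by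
  obtain ⟨q, rfl⟩ : ∃ q, p = q + 1 := ⟨p - 1, by omega⟩
  simp only [Nat.add_sub_cancel] at hkey ⊢
  have h1 : (-1 : ℚ) ^ (q + 1) ≠ 0 := pow_ne_zero _ (by norm_num)
  have h2 : (-1 : ℚ) ^ (q + 1) * (((P - 1) * β) * N) =
      (-1) ^ (q + 1) * ((P - 1) ^ (q + 1) * (α ^ (q + 1) *
        ((β / α) ^ (q + 1) - P * α * (β / α) + (P - 1) * β))) := by
    rw [← mul_assoc, hkey]; ring
  have h3 := mul_left_cancel₀ h1 h2
  apply mul_left_cancel₀ (mul_ne_zero hP hβ)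
  rw [h3, div_pow, pow_succ, pow_succ, pow_succ]
  field_simp
  ring

/-- `N_{K/ℚ}(ξ^{p-1} − v^{p-1}) = (p−1)^{p-1} (u^{p(p-1)} − v^{p(p-1)})`. [cite: Masser2002, §3 (3.9)] -/
theorem norm_primeRoot_pow_sub (hp : 2 ≤ p) (hu : 0 < u) (hv : 0 < v) :
    Algebra.norm ℚ ((primeRoot p u v) ^ (p - 1) - algebraMap ℚ _ ((v : ℚ) ^ (p - 1))) =
      ((p : ℚ) - 1) ^ (p - 1) * ((u : ℚ) ^ (p * (p - 1)) - (v : ℚ) ^ (p * (p - 1))) := by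
  set ξ := primeRoot p u v with hξ
  set α : ℚ := (v : ℚ) ^ (p - 1) with hα
  set β : ℚ := (u : ℚ) ^ p with hβ
  have hα0 : α ≠ 0 := by rw [hα]; positivity
  have hβ0 : β ≠ 0 := by rw [hβ]; positivity
  have hp1 : (p : ℚ) - 1 ≠ 0 := by
    have : (2 : ℚ) ≤ p := by exact_mod_cast hp
    linarith
  have hfin := finrank_masserPrimeField (p := p) (u := u) (v := v) hp
  -- norms of both sides of the key identity
  have hkey := congrArg (Algebra.norm ℚ) (primeRoot_mul_sub (p := p) (u := u) (v := v) hp)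
  rw [map_mul, map_mul, Algebra.norm_algebraMap, hfin] at hkey
  have hlin : algebraMap ℚ (MasserPrimeField p u v) α * ξ - algebraMap ℚ _ β =
      algebraMap ℚ _ α * (ξ - algebraMap ℚ _ (β / α)) := by
    rw [mul_sub, ← map_mul, mul_div_cancel₀ _ hα0]
  rw [← hα, ← hβ, hlin, map_mul, Algebra.norm_algebraMap, hfin, norm_primeRoot_sub hp,
    norm_primeRoot hp, masserPoly_eval] at hkey
  -- `B = (p-1) β`, `A = p α`
  have hA : (masserA p v : ℚ) = (p : ℚ) * α := by simp [masserA, hα]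
  have hB : (masserB p u : ℚ) = ((p : ℚ) - 1) * β := by
    simp only [masserB, hβ, Nat.cast_mul, Nat.cast_pow, Nat.cast_sub (show 1 ≤ p by omega),
      Nat.cast_one]
  rw [hA, hB] at hkey
  have hu' : (u : ℚ) ^ (p * (p - 1)) = β ^ (p - 1) := by rw [hβ, ← pow_mul]
  have hv' : (v : ℚ) ^ (p * (p - 1)) = α ^ p := by rw [hα, ← pow_mul, mul_comm]
  rw [hu', hv']
  exact norm_pow_sub_aux hp hα0 hβ0 hp1 hkey

/-- `N_{K/ℚ}(F'(ξ)) = p^p (p−1)^{p-1} (u^{p(p-1)} − v^{p(p-1)})`. [cite: Masser2002, §3 (3.9)] -/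
theorem norm_derivative_primeRoot (hp : 2 ≤ p) (hu : 0 < u) (hv : 0 < v) :
    Algebra.norm ℚ (aeval (primeRoot p u v) (derivative (masserPoly p u v))) =
      (p : ℚ) ^ p * ((p : ℚ) - 1) ^ (p - 1) * ((u : ℚ) ^ (p * (p - 1)) - (v : ℚ) ^ (p * (p - 1))) := by
  have hF' : derivative (masserPoly p u v) = C (p : ℚ) * X ^ (p - 1) - C (masserA p v : ℚ) := by
    unfold masserPoly
    rw [derivative_add, derivative_sub, derivative_X_pow, derivative_C_mul_X, derivative_C, add_zero]
  have hder : aeval (primeRoot p u v) (derivative (masserPoly p u v)) =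
      algebraMap ℚ _ (p : ℚ) *
        ((primeRoot p u v) ^ (p - 1) - algebraMap ℚ _ ((v : ℚ) ^ (p - 1))) := by
    rw [hF']
    simp only [map_sub, map_mul, map_pow, aeval_X, masserA, Nat.cast_mul, Nat.cast_pow,
      map_natCast]
    ring
  rw [hder, map_mul, Algebra.norm_algebraMap, finrank_masserPrimeField hp,
    norm_primeRoot_pow_sub hp hu hv]
  ring

/-- The discriminant of the power basis `(1, ξ, …, ξ^{p-1})`:
`(-1)^{p(p-1)/2} p^p (p−1)^{p-1} (u^{p(p-1)} − v^{p(p-1)})`. [cite: Masser2002, §3 (3.9)] -/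
theorem discr_powerBasis_primeRoot (hp : 2 ≤ p) (hu : 0 < u) (hv : 0 < v) :
    Algebra.discr ℚ (AdjoinRoot.powerBasis (masserPoly_ne_zero hp u v)).basis =
      (-1) ^ (p * (p - 1) / 2) * ((p : ℚ) ^ p * ((p : ℚ) - 1) ^ (p - 1) *
        ((u : ℚ) ^ (p * (p - 1)) - (v : ℚ) ^ (p * (p - 1)))) := by
  rw [Algebra.discr_powerBasis_eq_norm, finrank_masserPrimeField hp, AdjoinRoot.powerBasis_gen,
    minpoly_primeRoot hp, norm_derivative_primeRoot hp hu hv]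

end PrimeField

/-! ### The integral element `ω = (ξ − u) G(ξ) / M` and the discriminant bound in base degree `p` -/

section PrimeOmega

open Polynomial

variable {p u v : ℕ}

/-- The degenerate trinomial `F_u = X^p − p u^{p-1} X + (p−1) u^p` over `ℤ` (double root at `u`).
[cite: Masser2002, §3 (3.9)] -/
def degenPolyZ (p u : ℕ) : ℤ[X] := masserPolyZ p (masserA p u) (masserB p u)

/-- Casting `masserA`, `masserB` (for `p ≥ 1`). [folklore] -/
theorem cast_masserA_masserB {R : Type*} [CommRing R] (hp : 1 ≤ p) (u : ℕ) :
    ((masserA p u : ℕ) : R) = (p : R) * (u : R) ^ (p - 1) ∧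
      ((masserB p u : ℕ) : R) = ((p : R) - 1) * (u : R) ^ p := by
  constructor
  · simp [masserA]
  · simp only [masserB, Nat.cast_mul, Nat.cast_pow, Nat.cast_sub hp, Nat.cast_one]

/-- `F_u(u) = 0`. [folklore] -/
theorem degenPolyZ_isRoot (hp : 2 ≤ p) : (degenPolyZ p u).IsRoot (u : ℤ) := by
  obtain ⟨hA, hB⟩ := cast_masserA_masserB (R := ℤ) (show 1 ≤ p by omega) u
  rw [IsRoot, degenPolyZ, masserPolyZ_eval]
  rw [hA, hB]
  have : (p : ℤ) * (u : ℤ) ^ (p - 1) * u = (p : ℤ) * (u : ℤ) ^ p := by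
    rw [mul_assoc, ← pow_succ]; congr 2; omega
  rw [this]; ring

/-- `F_u'(u) = 0`. [folklore] -/
theorem degenPolyZ_derivative_isRoot (hp : 2 ≤ p) : (derivative (degenPolyZ p u)).IsRoot (u : ℤ) := by
  obtain ⟨hA, -⟩ := cast_masserA_masserB (R := ℤ) (show 1 ≤ p by omega) u
  rw [IsRoot, degenPolyZ, masserPolyZ, derivative_add, derivative_sub, derivative_X_pow,
    derivative_C_mul_X, derivative_C, add_zero, eval_sub, eval_mul, eval_C, eval_pow, eval_X, eval_C]
  rw [hA]; ring

/-- `(X − u)² ∣ F_u`. [cite: Masser2002, §3 (3.9)] -/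
theorem sq_dvd_degenPolyZ (hp : 2 ≤ p) : (X - C (u : ℤ)) ^ 2 ∣ degenPolyZ p u := by
  have h0 : degenPolyZ p u ≠ 0 := (masserPolyZ_monic hp _ _).ne_zero
  rw [← le_rootMultiplicity_iff h0]
  exact (one_lt_rootMultiplicity_iff_isRoot h0).mpr
    ⟨degenPolyZ_isRoot hp, degenPolyZ_derivative_isRoot hp⟩

/-- `G = F_u / (X − u)²`. [folklore] -/
def degenQuotZ (p u : ℕ) : ℤ[X] := degenPolyZ p u /ₘ (X - C (u : ℤ)) ^ 2

/-- `(X − u)² G = F_u`. [folklore] -/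
theorem sq_mul_degenQuotZ (hp : 2 ≤ p) : (X - C (u : ℤ)) ^ 2 * degenQuotZ p u = degenPolyZ p u := by
  have hmon : ((X - C (u : ℤ)) ^ 2).Monic := (monic_X_sub_C _).pow 2
  have h := modByMonic_add_div (degenPolyZ p u) ((X - C (u : ℤ)) ^ 2)
  rw [(modByMonic_eq_zero_iff_dvd hmon).mpr (sq_dvd_degenPolyZ hp), zero_add] at h
  exact h

/-- `T = (X − u) G`, so that `θ = T(ξ) = (ξ − u) G(ξ)`. [folklore] -/
def thetaPolyZ (p u : ℕ) : ℤ[X] := (X - C (u : ℤ)) * degenQuotZ p u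

/-- `(X − u) T = F_u`. [folklore] -/
theorem X_sub_C_mul_thetaPolyZ (hp : 2 ≤ p) : (X - C (u : ℤ)) * thetaPolyZ p u = degenPolyZ p u := by
  unfold thetaPolyZ
  rw [← mul_assoc, ← pow_two, sq_mul_degenQuotZ hp]

/-- `T` is monic. [folklore] -/
theorem thetaPolyZ_monic (hp : 2 ≤ p) : (thetaPolyZ p u).Monic :=
  Monic.of_mul_monic_left (monic_X_sub_C _)
    (by rw [X_sub_C_mul_thetaPolyZ hp]; exact masserPolyZ_monic hp _ _)

/-- `deg T = p − 1`. [folklore] -/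
theorem thetaPolyZ_natDegree (hp : 2 ≤ p) : (thetaPolyZ p u).natDegree = p - 1 := by
  have h := congrArg natDegree (X_sub_C_mul_thetaPolyZ (u := u) hp)
  rw [(monic_X_sub_C _).natDegree_mul (thetaPolyZ_monic hp), natDegree_X_sub_C, degenPolyZ,
    masserPolyZ_natDegree hp] at h
  omega

/-- `T² = G · F_u`. [folklore] -/
theorem thetaPolyZ_sq (hp : 2 ≤ p) : (thetaPolyZ p u) ^ 2 = degenQuotZ p u * degenPolyZ p u := by
  rw [← sq_mul_degenQuotZ hp]
  unfold thetaPolyZ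
  ring

/-- `F_u = F + (A − A_u) X` with `A = p v^{p-1}`, `A_u = p u^{p-1}`. [folklore] -/
theorem degenPolyZ_eq (p u v : ℕ) :
    degenPolyZ p u = masserPolyZ p (masserA p v) (masserB p u) +
      C ((masserA p v : ℤ) - (masserA p u : ℤ)) * X := by
  unfold degenPolyZ masserPolyZ
  simp only [map_sub]
  ring

variable [hirrp : Fact (Irreducible (masserPoly p u v))]

/-- `F(ξ) = 0` in `𝓞 K` (the `ℤ`-polynomial). [folklore] -/
theorem aeval_primeRootInt (hp : 2 ≤ p) :
    aeval (primeRootInt (u := u) (v := v) hp) (masserPolyZ p (masserA p v) (masserB p u)) = 0 := by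
  have h : aeval (primeRoot p u v)
      ((masserPolyZ p (masserA p v) (masserB p u)).map (algebraMap ℤ ℚ)) = 0 := by
    rw [← masserPoly_eq_map]; exact aeval_primeRoot
  rw [aeval_map_algebraMap] at h
  apply (FaithfulSMul.algebraMap_injective (𝓞 (MasserPrimeField p u v)) (MasserPrimeField p u v))
  rw [← aeval_algebraMap_apply, map_zero]
  exact h

/-- `θ = T(ξ) = (ξ − u) G(ξ) ∈ 𝓞 K`. [cite: Masser2002, §3 (3.9)] -/
def primeTheta (hp : 2 ≤ p) : 𝓞 (MasserPrimeField p u v) := aeval (primeRootInt hp) (thetaPolyZ p u)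

/-- `θ² = (A − A_u) · ξ · G(ξ)`. [folklore] -/
theorem primeTheta_sq (hp : 2 ≤ p) :
    (primeTheta (u := u) (v := v) hp) ^ 2 =
      (((masserA p v : ℤ) - (masserA p u : ℤ) : ℤ) : 𝓞 (MasserPrimeField p u v)) *
        (primeRootInt hp * aeval (primeRootInt hp) (degenQuotZ p u)) := by
  unfold primeTheta
  rw [← map_pow, thetaPolyZ_sq hp, map_mul, degenPolyZ_eq p u v, map_add, aeval_primeRootInt hp,
    zero_add, map_mul, aeval_C, aeval_X]
  simp only [algebraMap_int_eq, eq_intCast]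
  ring

/-- `ω = θ / M ∈ K`. [cite: Masser2002, §3 (3.9)] -/
def primeOmega (hp : 2 ≤ p) (M : ℕ) : MasserPrimeField p u v :=
  algebraMap ℚ _ ((M : ℚ)⁻¹) * (primeTheta (u := u) (v := v) hp : MasserPrimeField p u v)

/-- `ω` is an algebraic integer when `M² ∣ A − A_u` (its square is `c · ξ · G(ξ)`). [folklore] -/
theorem isIntegral_primeOmega (hp : 2 ≤ p) {M : ℕ} {c : ℤ}
    (hc : (masserA p v : ℤ) - (masserA p u : ℤ) = (M : ℤ) ^ 2 * c) :
    IsIntegral ℤ (primeOmega (u := u) (v := v) hp M) := by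
  by_cases hM : M = 0
  · unfold primeOmega
    rw [hM, Nat.cast_zero, inv_zero, map_zero, zero_mul]
    exact isIntegral_zero
  apply IsIntegral.of_pow (n := 2) (by norm_num)
  set y : 𝓞 (MasserPrimeField p u v) :=
    (c : 𝓞 (MasserPrimeField p u v)) * (primeRootInt hp * aeval (primeRootInt hp) (degenQuotZ p u))
    with hy
  have hθ : ((primeTheta (u := u) (v := v) hp : 𝓞 (MasserPrimeField p u v)) :
      MasserPrimeField p u v) ^ 2 = ((M : MasserPrimeField p u v)) ^ 2 * (y : MasserPrimeField p u v) := by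
    rw [RingOfIntegers.coe_eq_algebraMap, RingOfIntegers.coe_eq_algebraMap, ← map_pow,
      primeTheta_sq hp, hc, hy]
    simp only [map_mul, map_intCast, map_natCast, map_pow, Int.cast_mul, Int.cast_pow,
      Int.cast_natCast]
    ring
  have hω : (primeOmega (u := u) (v := v) hp M) ^ 2 = (y : MasserPrimeField p u v) := by
    unfold primeOmega
    rw [mul_pow, hθ, ← map_pow, ← mul_assoc]
    have hMK : (M : MasserPrimeField p u v) = algebraMap ℚ _ (M : ℚ) := by simp
    rw [hMK, ← map_pow, ← map_mul, inv_pow,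
      inv_mul_cancel₀ (pow_ne_zero _ (by exact_mod_cast hM : (M : ℚ) ≠ 0)), map_one, one_mul]
  rw [hω]
  exact RingOfIntegers.isIntegral_coe y

end PrimeOmega

/-! ### The basis `(1, ξ, …, ξ^{p-2}, ω)` and `|D_K| ≤ p^p (p−1)^{p-1} (v^{p(p-1)} − u^{p(p-1)})/M²` -/

section PrimeDiscr

open Polynomial Matrix

/-- `h_p = p^p (p − 1)^{p-1}` (the constant in `disc = ± h_p (ũ^N − u^N)`). [cite: Masser2002, §3 (3.9)] -/
def masserH (p : ℕ) : ℕ := p ^ p * (p - 1) ^ (p - 1)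

/-- `h_p` as a rational number. [folklore] -/
theorem cast_masserH {p : ℕ} (hp : 1 ≤ p) :
    ((masserH p : ℕ) : ℚ) = (p : ℚ) ^ p * ((p : ℚ) - 1) ^ (p - 1) := by
  simp only [masserH, Nat.cast_mul, Nat.cast_pow, Nat.cast_sub hp, Nat.cast_one]

/-- `h_p > 0` for `p ≥ 2`. [folklore] -/
theorem masserH_pos {p : ℕ} (hp : 2 ≤ p) : 0 < masserH p := by
  unfold masserH
  have : 0 < p - 1 := by omega
  positivity

variable {p u v : ℕ}

/-- The change of basis from `(1, ξ, …, ξ^{p-1})` to `(1, ξ, …, ξ^{p-2}, ω)`, `ω = T(ξ)/M`.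
[folklore] -/
def primeChange (p u M : ℕ) : Matrix (Fin p) (Fin p) ℚ := fun i j =>
  if (j : ℕ) = p - 1 then ((thetaPolyZ p u).coeff i : ℚ) * (M : ℚ)⁻¹ else (if i = j then 1 else 0)

/-- The change of basis is upper triangular. [folklore] -/
theorem primeChange_blockTriangular (p u M : ℕ) : (primeChange p u M).BlockTriangular id := by
  intro i j hij
  have hj : (j : ℕ) ≠ p - 1 := by
    have h1 : (j : ℕ) < (i : ℕ) := hij
    have h2 := i.2
    omega
  have hij' : i ≠ j := fun h => by rw [h] at hij; exact lt_irrefl _ hij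
  simp [primeChange, hj, hij']

/-- `det = 1/M`. [folklore] -/
theorem det_primeChange (hp : 2 ≤ p) (u M : ℕ) : (primeChange p u M).det = (M : ℚ)⁻¹ := by
  rw [Matrix.det_of_upperTriangular (primeChange_blockTriangular p u M)]
  have hlast : (⟨p - 1, by omega⟩ : Fin p) ∈ Finset.univ := Finset.mem_univ _
  rw [Finset.prod_eq_single (⟨p - 1, by omega⟩ : Fin p)]
  · have hc : (thetaPolyZ p u).coeff (p - 1) = 1 := by
      rw [← thetaPolyZ_natDegree (u := u) hp]
      exact (thetaPolyZ_monic hp).coeff_natDegree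
    simp [primeChange, hc]
  · intro i _ hi
    have hi' : (i : ℕ) ≠ p - 1 := fun h => hi (Fin.ext h)
    simp [primeChange, hi']
  · intro h; exact absurd hlast h

variable [hirrp : Fact (Irreducible (masserPoly p u v))]

/-- `θ = Σ_{i<p} T_i ξ^i` in `K`. [folklore] -/
theorem coe_primeTheta_eq_sum (hp : 2 ≤ p) :
    ((primeTheta (u := u) (v := v) hp : 𝓞 (MasserPrimeField p u v)) : MasserPrimeField p u v) =
      ∑ i : Fin p, (((thetaPolyZ p u).coeff i : ℤ) : MasserPrimeField p u v) *
        (primeRoot p u v) ^ (i : ℕ) := by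
  unfold primeTheta
  rw [RingOfIntegers.coe_eq_algebraMap, ← aeval_algebraMap_apply]
  have hξ : algebraMap (𝓞 (MasserPrimeField p u v)) (MasserPrimeField p u v) (primeRootInt hp) =
      primeRoot p u v := rfl
  rw [hξ, aeval_eq_sum_range' (by rw [thetaPolyZ_natDegree hp]; omega : (thetaPolyZ p u).natDegree < p),
    Finset.sum_range (fun i => (thetaPolyZ p u).coeff i • primeRoot p u v ^ i)]
  apply Finset.sum_congr rfl
  intro i _
  rw [Algebra.smul_def, eq_intCast]

/-- The family `(1, ξ, …, ξ^{p-2}, ω)`. [folklore] -/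
def primeFamily (hp : 2 ≤ p) (M : ℕ) : Fin p → MasserPrimeField p u v := fun j =>
  if (j : ℕ) = p - 1 then primeOmega (u := u) (v := v) hp M else (primeRoot p u v) ^ (j : ℕ)

/-- The power basis reindexed by `Fin p`. [folklore] -/
def primePowerBasis (hp : 2 ≤ p) : Module.Basis (Fin p) ℚ (MasserPrimeField p u v) :=
  (AdjoinRoot.powerBasis (masserPoly_ne_zero hp u v)).basis.reindex
    (finCongr (by rw [AdjoinRoot.powerBasis_dim, masserPoly_natDegree hp]))

/-- Values of the power basis. [folklore] -/
theorem primePowerBasis_apply (hp : 2 ≤ p) (i : Fin p) :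
    primePowerBasis (u := u) (v := v) hp i = (primeRoot p u v) ^ (i : ℕ) := by
  unfold primePowerBasis
  rw [Module.Basis.coe_reindex, Function.comp_apply, PowerBasis.coe_basis]
  simp

/-- Discriminant of the power basis (reindexed). [folklore] -/
theorem discr_primePowerBasis (hp : 2 ≤ p) (hu : 0 < u) (hv : 0 < v) :
    Algebra.discr ℚ (primePowerBasis (u := u) (v := v) hp) =
      (-1) ^ (p * (p - 1) / 2) * ((p : ℚ) ^ p * ((p : ℚ) - 1) ^ (p - 1) *
        ((u : ℚ) ^ (p * (p - 1)) - (v : ℚ) ^ (p * (p - 1)))) := by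
  unfold primePowerBasis
  rw [Module.Basis.coe_reindex, Algebra.discr_reindex, discr_powerBasis_primeRoot hp hu hv]

/-- The family is the power basis times the change of basis. [folklore] -/
theorem primeFamily_eq_vecMul (hp : 2 ≤ p) (M : ℕ) :
    primeFamily (u := u) (v := v) hp M =
      Matrix.vecMul (⇑(primePowerBasis (u := u) (v := v) hp))
        ((primeChange p u M).map (algebraMap ℚ (MasserPrimeField p u v))) := by
  funext j
  simp only [Matrix.vecMul, dotProduct, Matrix.map_apply, primePowerBasis_apply]
  by_cases hj : (j : ℕ) = p - 1
  · simp only [primeFamily, hj, if_true, primeChange]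
    unfold primeOmega
    rw [coe_primeTheta_eq_sum hp, Finset.mul_sum]
    apply Finset.sum_congr rfl
    intro i _
    simp only [map_mul, map_intCast, map_inv₀, map_natCast]
    ring
  · simp only [primeFamily, hj, if_false, primeChange]
    rw [Finset.sum_eq_single j]
    · simp
    · intro i _ hij
      simp [hij]
    · intro h; exact absurd (Finset.mem_univ j) h

/-- `disc(1, ξ, …, ξ^{p-2}, ω) = disc(1, …, ξ^{p-1}) / M²`. [folklore] -/
theorem discr_primeFamily (hp : 2 ≤ p) (hu : 0 < u) (hv : 0 < v) (M : ℕ) :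
    Algebra.discr ℚ (primeFamily (u := u) (v := v) hp M) =
      ((M : ℚ)⁻¹) ^ 2 * ((-1) ^ (p * (p - 1) / 2) * ((p : ℚ) ^ p * ((p : ℚ) - 1) ^ (p - 1) *
        ((u : ℚ) ^ (p * (p - 1)) - (v : ℚ) ^ (p * (p - 1))))) := by
  rw [primeFamily_eq_vecMul hp M, Algebra.discr_of_matrix_vecMul, det_primeChange hp,
    discr_primePowerBasis hp hu hv]

/-- The family is linearly independent (for `M ≠ 0`, `0 < u < v`). [folklore] -/
theorem linearIndependent_primeFamily (hp : 2 ≤ p) (hu : 0 < u) (huv : u < v) {M : ℕ} (hM : M ≠ 0) :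
    LinearIndependent ℚ (primeFamily (u := u) (v := v) hp M) := by
  by_contra hli
  have h0 := Algebra.discr_zero_of_not_linearIndependent ℚ hli
  rw [discr_primeFamily hp hu (lt_trans hu huv) M] at h0
  have hM' : (M : ℚ)⁻¹ ≠ 0 := inv_ne_zero (by exact_mod_cast hM)
  have hp1 : (p : ℚ) - 1 ≠ 0 := by
    have : (2 : ℚ) ≤ p := by exact_mod_cast hp
    linarith
  have hp0 : (p : ℚ) ≠ 0 := by
    have : (2 : ℚ) ≤ p := by exact_mod_cast hp
    linarith
  have huv' : (u : ℚ) ^ (p * (p - 1)) - (v : ℚ) ^ (p * (p - 1)) ≠ 0 := by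
    apply sub_ne_zero.mpr
    intro h
    have h' : (u : ℚ) ^ (p * (p - 1)) < (v : ℚ) ^ (p * (p - 1)) := by
      apply pow_lt_pow_left₀ (by exact_mod_cast huv) (by positivity)
      have : 0 < p - 1 := by omega
      positivity
    exact (ne_of_lt h') h
  apply (mul_ne_zero (pow_ne_zero 2 hM') (mul_ne_zero (pow_ne_zero _ (by norm_num))
    (mul_ne_zero (mul_ne_zero (pow_ne_zero _ hp0) (pow_ne_zero _ hp1)) huv'))) h0

/-- The `ℚ`-basis `(1, ξ, …, ξ^{p-2}, ω)`. [folklore] -/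
def primeBasis (hp : 2 ≤ p) (hu : 0 < u) (huv : u < v) {M : ℕ} (hM : M ≠ 0) :
    Module.Basis (Fin p) ℚ (MasserPrimeField p u v) :=
  haveI : Nonempty (Fin p) := ⟨⟨0, by omega⟩⟩
  basisOfLinearIndependentOfCardEqFinrank (linearIndependent_primeFamily hp hu huv hM)
    (by rw [finrank_masserPrimeField hp]; simp)

/-- Values of `primeBasis`. [folklore] -/
theorem coe_primeBasis (hp : 2 ≤ p) (hu : 0 < u) (huv : u < v) {M : ℕ} (hM : M ≠ 0) :
    ⇑(primeBasis (u := u) (v := v) hp hu huv hM) = primeFamily (u := u) (v := v) hp M := by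
  simp [primeBasis]

/-- **Discriminant step in base degree `p`**: if `M² ∣ p(v^{p-1} − u^{p-1})` then
`|D_K| ≤ h_p |k|` and `D_K ∣ h_p k` where `k = (v^{p(p-1)} − u^{p(p-1)})/M²`.
[cite: Masser2002, §3 (3.9)] -/
theorem abs_discr_masserPrimeField_le (hp : 2 ≤ p) (hu : 0 < u) (huv : u < v) {M : ℕ} (hM : M ≠ 0)
    {c k : ℤ} (hc : (masserA p v : ℤ) - (masserA p u : ℤ) = (M : ℤ) ^ 2 * c)
    (hk : (k : ℚ) = ((v : ℚ) ^ (p * (p - 1)) - (u : ℚ) ^ (p * (p - 1))) / (M : ℚ) ^ 2) :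
    |((NumberField.discr (MasserPrimeField p u v) : ℤ) : ℚ)| ≤ (masserH p : ℚ) * |(k : ℚ)| ∧
      NumberField.discr (MasserPrimeField p u v) ∣ (masserH p : ℤ) * k := by
  classical
  have hv : 0 < v := lt_trans hu huv
  have hint : ∀ i, IsIntegral ℤ (primeBasis (u := u) (v := v) hp hu huv hM i) := by
    intro i
    rw [coe_primeBasis]
    unfold primeFamily
    split_ifs
    · exact isIntegral_primeOmega hp hc
    · exact (isIntegral_primeRoot hp).pow _
  have hMQ : (M : ℚ) ≠ 0 := by exact_mod_cast hM
  have hdiscr : Algebra.discr ℚ (primeBasis (u := u) (v := v) hp hu huv hM) =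
      (((-1) ^ (p * (p - 1) / 2 + 1) * ((masserH p : ℕ) : ℤ) * k : ℤ) : ℚ) := by
    rw [coe_primeBasis, discr_primeFamily hp hu hv M]
    push_cast
    rw [cast_masserH (by omega), hk, pow_succ]
    field_simp
    ring
  refine ⟨?_, ?_⟩
  · refine le_trans (abs_discr_le_abs_discr_of_isIntegral _ hint) ?_
    rw [hdiscr]
    push_cast
    rw [abs_mul, abs_mul, abs_pow, abs_neg, abs_one, one_pow, one_mul, Nat.abs_cast]
  · have h := discr_dvd_of_isIntegral _ hint hdiscr
    have e : ((-1 : ℤ) ^ (p * (p - 1) / 2 + 1) * ((masserH p : ℕ) : ℤ) * k) =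
        (masserH p : ℤ) * k * (-1) ^ (p * (p - 1) / 2 + 1) := by ring
    rw [e] at h
    exact ((isUnit_neg_one.pow _).dvd_mul_right).mp h

end PrimeDiscr

/-! ### The algebraic core in prime base degree `p`: a field of degree `n = pe` with Masser's triple -/

section PrimeCore

open Polynomial

/-- `A = p v^{p-1} ≠ 0` and `B = (p−1) u^p ≠ 0` for `p ≥ 2`, `u, v > 0`. [folklore] -/
theorem masserA_ne_zero {p v : ℕ} (hp : 2 ≤ p) (hv : 0 < v) : masserA p v ≠ 0 := by
  unfold masserA; positivity

/-- See `masserA_ne_zero`. [folklore] -/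
theorem masserB_ne_zero {p u : ℕ} (hp : 2 ≤ p) (hu : 0 < u) : masserB p u ≠ 0 := by
  unfold masserB
  have : 0 < p - 1 := by omega
  positivity

/-- In any number field containing an algebraic integer root of `X^p − p v^{p-1} X + (p−1) u^p` we
get Masser's triple with `A = p v^{p-1}`, `B = (p−1) u^p`. [cite: Masser2002, §3 (3.7)–(3.8)] -/
theorem exists_masserTriple_prime {L : Type*} [Field L] [NumberField L] {p u v : ℕ} (hp : 2 ≤ p)
    (hu : 0 < u) (hv : 0 < v) (hcop : Nat.Coprime (masserA p v) (masserB p u)) (ξ : 𝓞 L)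
    (hξ : ξ ^ p = ((masserA p v : ℕ) : 𝓞 L) * ξ - ((masserB p u : ℕ) : 𝓞 L)) :
    ∃ a b c : L, a ≠ 0 ∧ b ≠ 0 ∧ c ≠ 0 ∧ a + b + c = 0 ∧
      ((masserA p v : ℕ) : ℝ) ^ Module.finrank ℚ L ≤ mulHeight ![a, b, c] ∧
      masserSupport a b c ≤
        (∏ q ∈ (masserA p v * masserB p u).primeFactors, q) ^ Module.finrank ℚ L :=
  exists_masserTriple (N := p) ξ hξ (by omega) hcop (masserA_ne_zero hp hv) (masserB_ne_zero hp hu)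

variable {p u v e r : ℕ}

/-- Prime core, generic case: Masser's trinomial irreducible, `L = K(r^{1/e})`. [folklore] -/
theorem exists_field_prime_core_irred (hp : 2 ≤ p) (hu : 0 < u) (hv : 0 < v)
    (hcop : Nat.Coprime (masserA p v) (masserB p u)) (he : 1 ≤ e) (hr : r.Prime)
    [Fact (Irreducible (masserPoly p u v))]
    [Fact (Irreducible (rootPolyK (MasserPrimeField p u v) e r))] :
    Module.finrank ℚ (BaseChangeField (MasserPrimeField p u v) e r) = p * e ∧
    (NumberField.discr (BaseChangeField (MasserPrimeField p u v) e r)).natAbs ≤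
      e ^ (p * e) * r ^ (p * (e - 1)) * (NumberField.discr (MasserPrimeField p u v)).natAbs ^ e ∧
    ∃ a b c : BaseChangeField (MasserPrimeField p u v) e r, a ≠ 0 ∧ b ≠ 0 ∧ c ≠ 0 ∧ a + b + c = 0 ∧
      ((masserA p v : ℕ) : ℝ) ^ (p * e) ≤ mulHeight ![a, b, c] ∧
      masserSupport a b c ≤ (∏ q ∈ (masserA p v * masserB p u).primeFactors, q) ^ (p * e) := by
  set ξK : 𝓞 (MasserPrimeField p u v) := primeRootInt hp with hξKdef
  have hξK : ξK ^ p = ((masserA p v : ℕ) : 𝓞 (MasserPrimeField p u v)) * ξK -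
      ((masserB p u : ℕ) : 𝓞 (MasserPrimeField p u v)) := by
    apply RingOfIntegers.ext
    simp only [hξKdef, primeRootInt, map_pow, RingOfIntegers.map_mk, map_sub, map_mul, map_natCast]
    exact primeRoot_pow
  set ξ : 𝓞 (BaseChangeField (MasserPrimeField p u v) e r) :=
    algebraMap (𝓞 (MasserPrimeField p u v)) (𝓞 (BaseChangeField (MasserPrimeField p u v) e r)) ξK
    with hξdef
  have hξ : ξ ^ p = ((masserA p v : ℕ) : 𝓞 (BaseChangeField (MasserPrimeField p u v) e r)) * ξ -
      ((masserB p u : ℕ) : 𝓞 (BaseChangeField (MasserPrimeField p u v) e r)) := by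
    rw [hξdef, ← map_pow, hξK]
    simp only [map_sub, map_mul, map_natCast]
  have hfin : Module.finrank ℚ (BaseChangeField (MasserPrimeField p u v) e r) = p * e := by
    rw [finrank_baseChangeField, finrank_masserPrimeField hp]
  obtain ⟨a, b, c, ha, hb, hc, habc, hH, hS⟩ := exists_masserTriple_prime hp hu hv hcop ξ hξ
  rw [hfin] at hH hS
  refine ⟨hfin, ?_, a, b, c, ha, hb, hc, habc, hH, hS⟩
  have hD := natAbs_discr_baseChangeField_le (K := MasserPrimeField p u v) (e := e) (r := r) he hr
  rwa [finrank_baseChangeField, finrank_masserPrimeField hp] at hD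

/-- Prime core, degenerate case: in `L = ℚ(2^{1/n})` with an integer root `q` of the trinomial.
[folklore] -/
theorem exists_field_prime_core_rat (hp : 2 ≤ p) (hu : 0 < u) (hv : 0 < v)
    (hcop : Nat.Coprime (masserA p v) (masserB p u)) {n : ℕ} (hn : 1 ≤ n) {q : ℤ}
    (hqeq : (masserPolyZ p (masserA p v) (masserB p u)).eval q = 0)
    [Fact (Irreducible (rootPolyK ℚ n 2))] :
    Module.finrank ℚ (BaseChangeField ℚ n 2) = n ∧
    (NumberField.discr (BaseChangeField ℚ n 2)).natAbs ≤ n ^ n * 2 ^ (n - 1) ∧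
    ∃ a b c : BaseChangeField ℚ n 2, a ≠ 0 ∧ b ≠ 0 ∧ c ≠ 0 ∧ a + b + c = 0 ∧
      ((masserA p v : ℕ) : ℝ) ^ n ≤ mulHeight ![a, b, c] ∧
      masserSupport a b c ≤ (∏ q ∈ (masserA p v * masserB p u).primeFactors, q) ^ n := by
  set ξ : 𝓞 (BaseChangeField ℚ n 2) := (q : 𝓞 (BaseChangeField ℚ n 2)) with hξdef
  have hξ : ξ ^ p = ((masserA p v : ℕ) : 𝓞 (BaseChangeField ℚ n 2)) * ξ -
      ((masserB p u : ℕ) : 𝓞 (BaseChangeField ℚ n 2)) := by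
    rw [masserPolyZ_eval] at hqeq
    have h := congrArg (fun z : ℤ => (z : 𝓞 (BaseChangeField ℚ n 2))) hqeq
    simp only [Int.cast_add, Int.cast_sub, Int.cast_pow, Int.cast_mul, Int.cast_natCast,
      Int.cast_zero] at h
    rw [hξdef]
    linear_combination h
  have hfin : Module.finrank ℚ (BaseChangeField ℚ n 2) = n := by
    rw [finrank_baseChangeField, Module.finrank_self, one_mul]
  obtain ⟨a, b, c, ha, hb, hc, habc, hH, hS⟩ := exists_masserTriple_prime hp hu hv hcop ξ hξ
  rw [hfin] at hH hS
  refine ⟨hfin, ?_, a, b, c, ha, hb, hc, habc, hH, hS⟩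
  have hD := natAbs_discr_baseChangeField_le (K := ℚ) (e := n) (r := 2) hn Nat.prime_two
  simp only [finrank_baseChangeField, Module.finrank_self, one_mul, Rat.numberField_discr,
    Int.natAbs_one, one_pow, mul_one] at hD
  exact hD

/-- **Algebraic core, prime base degree `p ≥ 3`.** Given `0 < u < v` with
`gcd(p v^{p-1}, (p−1) u^p) = 1`, a prime `ℓ ∣ v` with `p < ℓ`, `ℓ ∤ u`, of multiplicative order
`p − 1` mod `p`, `M ≠ 0` with `M² ∣ v − u`, `e ≥ 1` and a prime `r ∤ p(p−1)(v^N − u^N)`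
(`N = p(p−1)`), there is a number field `L` of degree `pe` with
`|D_L| ≤ (pe)^{pe} (2r)^{pe} (h_p (v^N−u^N)/M²)^e` containing nonzero `a + b + c = 0` with
`H_L ≥ (p v^{p-1})^{pe}` and `S_L ≤ rad(p v^{p-1} (p−1) u^p)^{pe}`. (Masser's §3 in degree `p`;
irreducibility of the trinomial is replaced by `irreducible_or_exists_root`, and a rational root
is handled in `ℚ(2^{1/pe})`.) [cite: Masser2002, §3 (3.6)–(3.9)] -/
theorem exists_field_prime_core {ℓ M : ℕ} (hprime : p.Prime) (hp3 : 3 ≤ p) (hu : 0 < u) (huv : u < v)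
    (hcop : Nat.Coprime (masserA p v) (masserB p u))
    (hℓ : ℓ.Prime) (hℓv : ℓ ∣ v) (hpℓ : p < ℓ) (hℓu : ¬ ℓ ∣ u)
    (hord : ∀ f : ℕ, 0 < f → ((ℓ : ZMod p)) ^ f = 1 → p - 1 ≤ f)
    (hM : M ≠ 0) (hMdvd : M ^ 2 ∣ v - u)
    (he : 1 ≤ e) (hr : r.Prime) (hrdvd : ¬ r ∣ p * (p - 1) * (v ^ (p * (p - 1)) - u ^ (p * (p - 1)))) :
    ∃ (L : Type) (_ : Field L) (_ : NumberField L),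
      Module.finrank ℚ L = p * e ∧
      (NumberField.discr L).natAbs ≤
        (p * e) ^ (p * e) * (2 * r) ^ (p * e) *
          (masserH p * ((v ^ (p * (p - 1)) - u ^ (p * (p - 1))) / M ^ 2)) ^ e ∧
      ∃ a b c : L, a ≠ 0 ∧ b ≠ 0 ∧ c ≠ 0 ∧ a + b + c = 0 ∧
        ((masserA p v : ℕ) : ℝ) ^ (p * e) ≤ mulHeight ![a, b, c] ∧
        masserSupport a b c ≤ (∏ q ∈ (masserA p v * masserB p u).primeFactors, q) ^ (p * e) := by
  classical
  have hp : 2 ≤ p := by omega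
  have hv : 0 < v := lt_trans hu huv
  have hNpos : 0 < p * (p - 1) := Nat.mul_pos (by omega) (by omega)
  have huvN : u ^ (p * (p - 1)) < v ^ (p * (p - 1)) := Nat.pow_lt_pow_left huv hNpos.ne'
  have hM2dvdN : M ^ 2 ∣ v ^ (p * (p - 1)) - u ^ (p * (p - 1)) :=
    dvd_trans hMdvd (Nat.sub_dvd_pow_sub_pow v u _)
  obtain ⟨k, hk⟩ := hM2dvdN
  have hkpos : 0 < k := by
    rcases Nat.eq_zero_or_pos k with h | h
    · rw [h, mul_zero] at hk; omega
    · exact h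
  have hkdiv : (v ^ (p * (p - 1)) - u ^ (p * (p - 1))) / M ^ 2 = k := by
    rw [hk, Nat.mul_div_cancel_left _ (by positivity)]
  have hkQ : ((k : ℤ) : ℚ) = ((v : ℚ) ^ (p * (p - 1)) - (u : ℚ) ^ (p * (p - 1))) / (M : ℚ) ^ 2 := by
    have hsub : ((v ^ (p * (p - 1)) - u ^ (p * (p - 1)) : ℕ) : ℚ) =
        (v : ℚ) ^ (p * (p - 1)) - (u : ℚ) ^ (p * (p - 1)) := by
      rw [Nat.cast_sub huvN.le]; push_cast; ring
    rw [eq_div_iff (by positivity), ← hsub, hk]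
    push_cast; ring
  -- `M² c = A_v − A_u`
  have huv1 : u ^ (p - 1) ≤ v ^ (p - 1) := Nat.pow_le_pow_left huv.le _
  have hM2dvdA : M ^ 2 ∣ masserA p v - masserA p u := by
    unfold masserA
    rw [← Nat.mul_sub]
    exact Dvd.dvd.mul_left (dvd_trans hMdvd (Nat.sub_dvd_pow_sub_pow v u (p - 1))) _
  obtain ⟨c, hc⟩ := hM2dvdA
  have hcZ : (masserA p v : ℤ) - (masserA p u : ℤ) = (M : ℤ) ^ 2 * c := by
    have hle : masserA p u ≤ masserA p v := Nat.mul_le_mul_left _ huv1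
    have := congrArg (fun z : ℕ => (z : ℤ)) hc
    simp only [Nat.cast_sub hle, Nat.cast_mul, Nat.cast_pow] at this
    exact this
  have hr1 : 1 ≤ 2 * r := by have := hr.one_lt; omega
  have h1k : 1 ≤ masserH p * k := Nat.one_le_iff_ne_zero.mpr (Nat.mul_ne_zero (masserH_pos hp).ne' hkpos.ne')
  rw [hkdiv]
  -- irreducible, or an integer root
  have hℓp : ℓ ≠ p := by omega
  have hℓA : (ℓ : ℤ) ∣ (masserA p v : ℕ) := by
    have : ℓ ∣ masserA p v := by
      unfold masserA
      exact Dvd.dvd.mul_left (dvd_trans hℓv (dvd_pow_self v (by omega))) _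
    exact_mod_cast this
  have hℓB : ¬ (ℓ : ℤ) ∣ (masserB p u : ℕ) := by
    intro h
    have h' : ℓ ∣ masserB p u := by exact_mod_cast h
    unfold masserB at h'
    rcases (Nat.Prime.dvd_mul hℓ).mp h' with h1 | h1
    · have := Nat.le_of_dvd (by omega) h1; omega
    · exact hℓu (hℓ.dvd_of_dvd_pow h1)
  rcases irreducible_or_exists_root hprime hp3 hℓ hℓp hℓA hℓB hord with hirr | ⟨q, hq⟩
  · -- the generic case
    rw [← masserPoly_eq_map] at hirr
    haveI : Fact (Irreducible (masserPoly p u v)) := ⟨hirr⟩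
    obtain ⟨hDKabs, hDK⟩ := abs_discr_masserPrimeField_le (u := u) (v := v) hp hu huv hM hcZ hkQ
    have hrD : ¬ (r : ℤ) ∣ NumberField.discr (MasserPrimeField p u v) := by
      intro hrdiscr
      have h1 : (r : ℤ) ∣ (masserH p : ℤ) * k := dvd_trans hrdiscr hDK
      have h2 : r ∣ masserH p * k := by exact_mod_cast h1
      apply hrdvd
      unfold masserH at h2
      rcases (Nat.Prime.dvd_mul hr).mp h2 with h3 | h3
      · rcases (Nat.Prime.dvd_mul hr).mp h3 with h4 | h4
        · exact Dvd.dvd.mul_right (Dvd.dvd.mul_right (hr.dvd_of_dvd_pow h4) _) _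
        · exact Dvd.dvd.mul_right (Dvd.dvd.mul_left (hr.dvd_of_dvd_pow h4) _) _
      · rw [hk]
        exact Dvd.dvd.mul_left (Dvd.dvd.mul_left h3 _) _
    haveI : Fact (Irreducible (rootPolyK (MasserPrimeField p u v) e r)) :=
      ⟨irreducible_rootPolyK he hr hrD⟩
    obtain ⟨hfin, hD, a, b, c', ha, hb, hc', habc, hH, hS⟩ :=
      exists_field_prime_core_irred (e := e) (r := r) hp hu hv hcop he hr
    refine ⟨BaseChangeField (MasserPrimeField p u v) e r, inferInstance, inferInstance, hfin, ?_,
      a, b, c', ha, hb, hc', habc, hH, hS⟩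
    have hDK' : (NumberField.discr (MasserPrimeField p u v)).natAbs ≤ masserH p * k := by
      have : |((NumberField.discr (MasserPrimeField p u v) : ℤ) : ℚ)| ≤ (masserH p : ℚ) * (k : ℚ) := by
        have h := hDKabs
        rwa [show |((k : ℤ) : ℚ)| = (k : ℚ) from abs_of_nonneg (by positivity)] at h
      have h2 : ((NumberField.discr (MasserPrimeField p u v)).natAbs : ℚ) ≤ ((masserH p * k : ℕ) : ℚ) := by
        rw [Nat.cast_natAbs, Int.cast_abs]; push_cast; exact this
      exact_mod_cast h2
    calc (NumberField.discr (BaseChangeField (MasserPrimeField p u v) e r)).natAbs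
        ≤ e ^ (p * e) * r ^ (p * (e - 1)) * (NumberField.discr (MasserPrimeField p u v)).natAbs ^ e :=
          hD
      _ ≤ (p * e) ^ (p * e) * (2 * r) ^ (p * e) * (masserH p * k) ^ e := by
        apply Nat.mul_le_mul (Nat.mul_le_mul ?_ ?_) ?_
        · exact Nat.pow_le_pow_left (Nat.le_mul_of_pos_left e (by omega)) _
        · exact le_trans (Nat.pow_le_pow_right hr.pos (Nat.mul_le_mul_left p (Nat.sub_le e 1)))
            (Nat.pow_le_pow_left (by omega) _)
        · exact Nat.pow_le_pow_left hDK' _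
  · -- the degenerate case: an integer root `q`; use `L = ℚ(2^{1/pe})`
    have hrD : ¬ ((2 : ℕ) : ℤ) ∣ NumberField.discr ℚ := by
      rw [Rat.numberField_discr]; norm_num
    have hn : 1 ≤ p * e := Nat.one_le_iff_ne_zero.mpr (Nat.mul_ne_zero (by omega) (by omega))
    haveI : Fact (Irreducible (rootPolyK ℚ (p * e) 2)) :=
      ⟨irreducible_rootPolyK hn Nat.prime_two hrD⟩
    obtain ⟨hfin, hD, a, b, c', ha, hb, hc', habc, hH, hS⟩ :=
      exists_field_prime_core_rat hp hu hv hcop hn hq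
    refine ⟨BaseChangeField ℚ (p * e) 2, inferInstance, inferInstance, hfin, ?_,
      a, b, c', ha, hb, hc', habc, hH, hS⟩
    calc (NumberField.discr (BaseChangeField ℚ (p * e) 2)).natAbs
        ≤ (p * e) ^ (p * e) * 2 ^ (p * e - 1) := hD
      _ ≤ (p * e) ^ (p * e) * (2 * r) ^ (p * e) * (masserH p * k) ^ e := by
        have h1 : 2 ^ (p * e - 1) ≤ (2 * r) ^ (p * e) :=
          le_trans (Nat.pow_le_pow_right (by norm_num) (Nat.sub_le _ _))
            (Nat.pow_le_pow_left (by have := hr.two_le; omega) _)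
        have h2 : 1 ≤ (masserH p * k) ^ e := Nat.one_le_pow _ _ h1k
        calc (p * e) ^ (p * e) * 2 ^ (p * e - 1) ≤ (p * e) ^ (p * e) * (2 * r) ^ (p * e) :=
              Nat.mul_le_mul_left _ h1
          _ = (p * e) ^ (p * e) * (2 * r) ^ (p * e) * 1 := (mul_one _).symm
          _ ≤ (p * e) ^ (p * e) * (2 * r) ^ (p * e) * (masserH p * k) ^ e := Nat.mul_le_mul_left _ h2

end PrimeCore

/-! ### Bookkeeping and the final step in prime base degree `p` -/

section PrimeAssembly

open Finset Chebyshev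

/-- The radical of `p v^{p-1} · (p−1) u^p` is at most `primorial(p) · Y^{#P}` when all prime factors
of `uv` lie in a set `P` of primes `q` with `p < q ≤ Y`. [folklore] -/
theorem rad_masserAB_le {p u v Y : ℕ} (hp : 2 ≤ p) {P : Finset ℕ} (hPY : ∀ q ∈ P, q ≤ Y)
    (hPp : ∀ q ∈ P, q.Prime ∧ p < q) (huv : ∀ q : ℕ, q.Prime → q ∣ u * v → q ∈ P) :
    ∏ q ∈ (masserA p v * masserB p u).primeFactors, q ≤ primorial p * Y ^ P.card := by
  classical
  set S₀ : Finset ℕ := (Finset.range (p + 1)).filter Nat.Prime with hS₀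
  have hsub : (masserA p v * masserB p u).primeFactors ⊆ S₀ ∪ P := by
    intro q hq
    have hqprime := Nat.prime_of_mem_primeFactors hq
    have hqdvd := Nat.dvd_of_mem_primeFactors hq
    rw [Finset.mem_union]
    unfold masserA masserB at hqdvd
    rcases (Nat.Prime.dvd_mul hqprime).mp hqdvd with hA | hB
    · rcases (Nat.Prime.dvd_mul hqprime).mp hA with h1 | h1
      · left
        rw [hS₀, Finset.mem_filter, Finset.mem_range]
        exact ⟨by have := Nat.le_of_dvd (by omega) h1; omega, hqprime⟩
      · right; exact huv q hqprime (Dvd.dvd.mul_left (hqprime.dvd_of_dvd_pow h1) u)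
    · rcases (Nat.Prime.dvd_mul hqprime).mp hB with h1 | h1
      · left
        rw [hS₀, Finset.mem_filter, Finset.mem_range]
        exact ⟨by have := Nat.le_of_dvd (by omega) h1; omega, hqprime⟩
      · right; exact huv q hqprime (Dvd.dvd.mul_right (hqprime.dvd_of_dvd_pow h1) v)
  have hdisj : Disjoint S₀ P := by
    rw [Finset.disjoint_left]
    intro q hq hqP
    rw [hS₀, Finset.mem_filter, Finset.mem_range] at hq
    have := (hPp q hqP).2
    omega
  calc ∏ q ∈ (masserA p v * masserB p u).primeFactors, q ≤ ∏ q ∈ S₀ ∪ P, q := by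
        apply Finset.prod_le_prod_of_subset_of_one_le' hsub
        intro q hq _
        rcases Finset.mem_union.mp hq with h | h
        · rw [hS₀, Finset.mem_filter] at h; exact h.2.one_lt.le
        · exact (hPp q h).1.one_lt.le
    _ = (∏ q ∈ S₀, q) * ∏ q ∈ P, q := Finset.prod_union hdisj
    _ ≤ primorial p * Y ^ P.card := by
        apply Nat.mul_le_mul (le_of_eq (by rw [hS₀]; rfl))
        calc ∏ q ∈ P, q ≤ ∏ _q ∈ P, Y := Finset.prod_le_prod' fun q hq => hPY q hq
          _ = Y ^ P.card := Finset.prod_const Y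

/-- `log (n^n (2r)^n (h v^N/M²)^e) = n log n + n log(2r) + e log h + e N log v − 2e log M`.
[folklore] -/
theorem log_discr_bound_eqP {n e r N : ℕ} {h v M : ℝ} (hn : 1 ≤ n) (hr : 1 ≤ r) (hh : 0 < h)
    (hv : 0 < v) (hM : 0 < M) :
    Real.log ((n : ℝ) ^ n * (2 * (r : ℝ)) ^ n * (h * (v ^ N / M ^ 2)) ^ e) =
      n * Real.log n + n * Real.log (2 * (r : ℝ)) + e * Real.log h + e * N * Real.log v -
        2 * e * Real.log M := by
  have hnR : (0 : ℝ) < n := by exact_mod_cast hn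
  have hrR : (0 : ℝ) < r := by exact_mod_cast hr
  have h4 : Real.log (h * (v ^ N / M ^ 2)) = Real.log h + N * Real.log v - 2 * Real.log M := by
    rw [Real.log_mul hh.ne' (by positivity), Real.log_div (by positivity) (by positivity),
      Real.log_pow, Real.log_pow]
    push_cast; ring
  rw [Real.log_mul (by positivity) (by positivity), Real.log_mul (by positivity) (by positivity),
    Real.log_pow, Real.log_pow, Real.log_pow, h4]
  ring

/-- The final step in prime base degree `p`: from the core field and the numerical hypothesis to
the strict inequality `C · D · φ_ν(D) · S^λ < H`. [cite: Masser2002, §3 (3.10)] -/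
theorem prime_final_step {p e : ℕ} (hp : 2 ≤ p) (he : 1 ≤ e) (l ν C : ℝ) (hl : 1 ≤ l) {Y E T : ℕ}
    (hY : 2 ≤ Y) {P : Finset ℕ} (hPY : ∀ q ∈ P, q ≤ Y) (hPp : ∀ q ∈ P, q.Prime ∧ p < q)
    (hneed : Real.log C +
        ((Real.log 3) ^ ν +
          ((p * e : ℕ) * Real.log (p * e : ℕ) + (p * e : ℕ) * Real.log (2 * (T : ℝ)) +
            e * Real.log (masserH p) +
            e * ((p * (p - 1) : ℕ) : ℝ) * ((Y : ℝ) * E * Real.log Y)) ^ ν) / Real.log (Real.log 3) +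
        (p * e : ℕ) * Real.log (p * e : ℕ) + (p * e : ℕ) * Real.log (2 * (T : ℝ)) +
        e * Real.log (masserH p) + e * Real.log 2 + 2 * e * Real.log (2 * (Y : ℝ)) +
        l * (p * e : ℕ) * (Real.log (primorial p) + P.card * Real.log Y) <
        e * (P.card * Real.log ((E : ℝ) + 1)))
    {m : ℕ} (hmprime : m.Prime) (hm2Y : m ≤ 2 * Y) (hB : 2 ≤ (E + 1) ^ P.card)
    {u v r : ℕ} (hv : 0 < v) (hsmooth : ∀ q : ℕ, q.Prime → q ∣ u * v → q ∈ P)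
    (hrT : r ≤ T) (hr : r.Prime)
    {L : Type*} [Field L] [NumberField L] (hfin : Module.finrank ℚ L = p * e)
    (hD : (NumberField.discr L).natAbs ≤
      (p * e) ^ (p * e) * (2 * r) ^ (p * e) *
        (masserH p * ((v ^ (p * (p - 1)) - u ^ (p * (p - 1))) /
          (m ^ (Nat.log m ((E + 1) ^ P.card - 1) / 2)) ^ 2)) ^ e)
    {a b c : L} (hH : ((masserA p v : ℕ) : ℝ) ^ (p * e) ≤ mulHeight ![a, b, c])
    (hS : masserSupport a b c ≤ (∏ q ∈ (masserA p v * masserB p u).primeFactors, q) ^ (p * e))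
    (hlogv : Real.log v ≤ (Y : ℝ) * E * Real.log Y)
    (hMpos : 0 < m ^ (Nat.log m ((E + 1) ^ P.card - 1) / 2)) :
    C * |(NumberField.discr L : ℝ)| * masserPhi ν |(NumberField.discr L : ℝ)| *
        (masserSupport a b c : ℝ) ^ l < mulHeight ![a, b, c] := by
  -- notation for the real quantities
  set M : ℕ := m ^ (Nat.log m ((E + 1) ^ P.card - 1) / 2) with hMdef
  set H : ℝ := mulHeight ![a, b, c] with hHdef
  set D : ℝ := |((NumberField.discr L : ℤ) : ℝ)| with hDdef
  set S : ℝ := (masserSupport a b c : ℝ) with hSdef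
  set nR : ℝ := ((p * e : ℕ) : ℝ) with hnRdef
  set NR : ℝ := ((p * (p - 1) : ℕ) : ℝ) with hNRdef
  set hR : ℝ := (masserH p : ℝ) with hhRdef
  have hvR : (0 : ℝ) < v := by exact_mod_cast hv
  have hn1 : 1 ≤ p * e := Nat.one_le_iff_ne_zero.mpr (Nat.mul_ne_zero (by omega) (by omega))
  have hnR1 : (1 : ℝ) ≤ nR := by rw [hnRdef]; exact_mod_cast hn1
  have hhR1 : (1 : ℝ) ≤ hR := by rw [hhRdef]; exact_mod_cast masserH_pos hp
  have hApos : (0 : ℝ) < ((masserA p v : ℕ) : ℝ) := by exact_mod_cast Nat.pos_of_ne_zero (masserA_ne_zero hp hv)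
  have hHpos : 0 < H := lt_of_lt_of_le (by positivity) hH
  have hS1 : (1 : ℝ) ≤ S := by rw [hSdef]; exact_mod_cast one_le_masserSupport a b c
  have hSpos : 0 < S := by linarith
  have hDnat : D = ((NumberField.discr L).natAbs : ℝ) := by
    rw [hDdef, Nat.cast_natAbs, Int.cast_abs]
  have hD3 : (3 : ℝ) ≤ D := by
    have hn2 : 2 ≤ p * e := le_trans hp (Nat.le_mul_of_pos_right p (by omega))
    have h2 : (2 : ℤ) < |NumberField.discr L| := NumberField.abs_discr_gt_two (by rw [hfin]; omega)
    have : ((3 : ℤ) : ℝ) ≤ ((|NumberField.discr L| : ℤ) : ℝ) := by exact_mod_cast h2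
    simpa [hDdef, Int.cast_abs] using this
  have hDpos' : 0 < D := by linarith
  have hφpos : 0 < masserPhi ν D := masserPhi_pos ν D
  -- Case `C ≤ 0`
  rcases le_or_gt C 0 with hC | hC
  · have : C * D * masserPhi ν D * S ^ l ≤ 0 := by
      have h1 : C * D ≤ 0 := mul_nonpos_of_nonpos_of_nonneg hC hDpos'.le
      have h2 : C * D * masserPhi ν D ≤ 0 := mul_nonpos_of_nonpos_of_nonneg h1 hφpos.le
      exact mul_nonpos_of_nonpos_of_nonneg h2 (Real.rpow_nonneg hSpos.le l)
    exact lt_of_le_of_lt this hHpos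
  -- Case `C > 0`: compare logarithms.
  have hLHSpos : 0 < C * D * masserPhi ν D * S ^ l := by positivity
  rw [← Real.log_lt_log_iff hLHSpos hHpos]
  have hlogLHS : Real.log (C * D * masserPhi ν D * S ^ l) =
      Real.log C + Real.log D + Real.log D ^ ν / Real.log (Real.log D) + l * Real.log S := by
    rw [Real.log_mul (by positivity) (by positivity), Real.log_mul (by positivity) hφpos.ne',
      Real.log_mul hC.ne' hDpos'.ne', Real.log_rpow hSpos]
    unfold masserPhi
    rw [Real.log_exp]
  rw [hlogLHS]
  -- lower bound for `log H`: `log H ≥ n log A ≥ e N log v`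
  have hlogA : ((p - 1 : ℕ) : ℝ) * Real.log v ≤ Real.log ((masserA p v : ℕ) : ℝ) := by
    have hA : ((masserA p v : ℕ) : ℝ) = (p : ℝ) * (v : ℝ) ^ (p - 1) := by simp [masserA]
    rw [hA, Real.log_mul (by positivity) (by positivity), Real.log_pow]
    have : 0 ≤ Real.log (p : ℝ) := Real.log_nonneg (by exact_mod_cast (show 1 ≤ p by omega))
    linarith
  have hlogH : (e : ℝ) * NR * Real.log v ≤ Real.log H := by
    have h1 : Real.log ((((masserA p v : ℕ) : ℝ)) ^ (p * e)) ≤ Real.log H :=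
      Real.log_le_log (by positivity) hH
    rw [Real.log_pow] at h1
    have h2 : (e : ℝ) * NR * Real.log v = ((p * e : ℕ) : ℝ) * (((p - 1 : ℕ) : ℝ) * Real.log v) := by
      rw [hNRdef]; push_cast; ring
    rw [h2]
    exact le_trans (mul_le_mul_of_nonneg_left hlogA (by positivity)) h1
  -- upper bound for `D`
  have hMR : (0 : ℝ) < M := by exact_mod_cast hMpos
  have hkk : (((v ^ (p * (p - 1)) - u ^ (p * (p - 1))) / M ^ 2 : ℕ) : ℝ) ≤
      (v : ℝ) ^ (p * (p - 1)) / (M : ℝ) ^ 2 := by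
    rw [le_div_iff₀ (by positivity)]
    have h1 : (v ^ (p * (p - 1)) - u ^ (p * (p - 1))) / M ^ 2 * M ^ 2 ≤ v ^ (p * (p - 1)) :=
      le_trans (Nat.div_mul_le_self _ _) (Nat.sub_le _ _)
    exact_mod_cast h1
  have hDle : D ≤ nR ^ (p * e) * (2 * (r : ℝ)) ^ (p * e) *
      (hR * ((v : ℝ) ^ (p * (p - 1)) / (M : ℝ) ^ 2)) ^ e := by
    rw [hDnat]
    have h1 : ((NumberField.discr L).natAbs : ℝ) ≤
        (((p * e) ^ (p * e) * (2 * r) ^ (p * e) *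
          (masserH p * ((v ^ (p * (p - 1)) - u ^ (p * (p - 1))) / M ^ 2)) ^ e : ℕ) : ℝ) := by
      exact_mod_cast hD
    refine le_trans h1 ?_
    rw [hnRdef, hhRdef]
    push_cast
    gcongr
  have hlogD : Real.log D ≤ nR * Real.log nR + nR * Real.log (2 * (r : ℝ)) + e * Real.log hR +
      e * NR * Real.log v - 2 * e * Real.log M := by
    have h1 := Real.log_le_log hDpos' hDle
    rw [hnRdef, log_discr_bound_eqP hn1 hr.one_lt.le (by linarith) hvR hMR] at h1
    rw [hnRdef, hNRdef]
    exact h1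
  have hlogr : Real.log (2 * (r : ℝ)) ≤ Real.log (2 * (T : ℝ)) := by
    apply Real.log_le_log (by have := hr.pos; positivity)
    exact_mod_cast Nat.mul_le_mul_left 2 hrT
  have hlogr' : nR * Real.log (2 * (r : ℝ)) ≤ nR * Real.log (2 * (T : ℝ)) :=
    mul_le_mul_of_nonneg_left hlogr (by linarith)
  -- `(log D)^ν / log log D ≤ ((log 3)^ν + Λ^ν) / log log 3`
  have hlogD0 : 0 ≤ Real.log D := Real.log_nonneg (by linarith)
  have hlogM0 : 0 ≤ Real.log M := Real.log_nonneg (by exact_mod_cast hMpos)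
  have hlogDΛ : Real.log D ≤ nR * Real.log nR + nR * Real.log (2 * (T : ℝ)) + e * Real.log hR +
      e * NR * ((Y : ℝ) * E * Real.log Y) := by
    have h2 : (e : ℝ) * NR * Real.log v ≤ e * NR * ((Y : ℝ) * E * Real.log Y) :=
      mul_le_mul_of_nonneg_left hlogv (by positivity)
    have h3 : 0 ≤ 2 * (e : ℝ) * Real.log M := by positivity
    linarith
  have hlog3 : 0 < Real.log 3 := Real.log_pos (by norm_num)
  have hΛ0 : 0 ≤ nR * Real.log nR + nR * Real.log (2 * (T : ℝ)) + e * Real.log hR +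
      e * NR * ((Y : ℝ) * E * Real.log Y) := le_trans hlogD0 hlogDΛ
  have hpowν : Real.log D ^ ν ≤ Real.log 3 ^ ν + (nR * Real.log nR + nR * Real.log (2 * (T : ℝ)) +
      e * Real.log hR + e * NR * ((Y : ℝ) * E * Real.log Y)) ^ ν := by
    rcases le_or_gt 0 ν with hν | hν
    · have := Real.rpow_le_rpow hlogD0 hlogDΛ hν
      have h0 : 0 ≤ Real.log 3 ^ ν := Real.rpow_nonneg hlog3.le ν
      linarith
    · have hle : Real.log 3 ≤ Real.log D := Real.log_le_log (by norm_num) hD3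
      have := Real.rpow_le_rpow_of_nonpos hlog3 hle hν.le
      have h0 := Real.rpow_nonneg hΛ0 ν
      linarith
  have hll : Real.log (Real.log 3) ≤ Real.log (Real.log D) :=
    Real.log_le_log hlog3 (Real.log_le_log (by norm_num) hD3)
  have hfrac : Real.log D ^ ν / Real.log (Real.log D) ≤
      (Real.log 3 ^ ν + (nR * Real.log nR + nR * Real.log (2 * (T : ℝ)) +
        e * Real.log hR + e * NR * ((Y : ℝ) * E * Real.log Y)) ^ ν) / Real.log (Real.log 3) := by
    apply div_le_div₀ _ hpowν log_log_three_pos hll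
    exact add_nonneg (Real.rpow_nonneg hlog3.le ν) (Real.rpow_nonneg hΛ0 ν)
  -- `l log S ≤ l n (log primorial(p) + k log Y)`
  have hY' : (0 : ℝ) < Y := by exact_mod_cast (show 0 < Y by omega)
  have hlogS : Real.log S ≤ nR * (Real.log (primorial p) + P.card * Real.log Y) := by
    have h1 : masserSupport a b c ≤ (primorial p * Y ^ P.card) ^ (p * e) :=
      le_trans hS (Nat.pow_le_pow_left (rad_masserAB_le hp hPY hPp hsmooth) _)
    have h2 : S ≤ (((primorial p * Y ^ P.card : ℕ) : ℝ)) ^ (p * e) := by rw [hSdef]; exact_mod_cast h1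
    calc Real.log S ≤ Real.log ((((primorial p * Y ^ P.card : ℕ) : ℝ)) ^ (p * e)) :=
          Real.log_le_log hSpos h2
      _ = nR * Real.log (((primorial p * Y ^ P.card : ℕ) : ℝ)) := by rw [Real.log_pow, hnRdef]
      _ = nR * (Real.log (primorial p) + P.card * Real.log Y) := by
          push_cast
          rw [Real.log_mul (by exact_mod_cast (primorial_pos p).ne') (by positivity), Real.log_pow]
  have hlθ : l * Real.log S ≤ l * (nR * (Real.log (primorial p) + P.card * Real.log Y)) :=
    mul_le_mul_of_nonneg_left hlogS (by linarith)
  -- `2 e log M ≥ e (k log (E+1) − log 2 − 2 log 2Y)`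
  have hMlog := log_modulus_ge (E := E) (k := P.card) hm2Y hmprime.two_le hB
  have hMlog' : (e : ℝ) * ((P.card : ℝ) * Real.log ((E : ℝ) + 1) - Real.log 2 -
      2 * Real.log (2 * (Y : ℝ))) ≤ 2 * e * Real.log M := by
    have := mul_le_mul_of_nonneg_left hMlog (show (0 : ℝ) ≤ e by positivity)
    rw [hMdef]; push_cast
    linarith
  have heR : (1 : ℝ) ≤ e := by exact_mod_cast he
  have hexp : l * (nR * (Real.log (primorial p) + P.card * Real.log Y)) =
      l * nR * (Real.log (primorial p) + P.card * Real.log Y) := by ring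
  rw [hexp] at hlθ
  linarith [hlogH, hlogD, hlogr', hfrac, hlθ, hMlog', hneed]

/-- The primes `q` with `p < q ≤ Y` and `q ≡ g (mod p)` (the smooth set in prime base degree).
[folklore] -/
def primesModEq (p : ℕ) (g : ZMod p) (Y : ℕ) : Finset ℕ :=
  (Finset.range (Y + 1)).filter (fun q => q.Prime ∧ p < q ∧ (q : ZMod p) = g)

/-- Membership in `primesModEq`. [folklore] -/
theorem mem_primesModEq {p Y q : ℕ} {g : ZMod p} :
    q ∈ primesModEq p g Y ↔ q ≤ Y ∧ q.Prime ∧ p < q ∧ (q : ZMod p) = g := by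
  simp [primesModEq]

/-- `#(primesModEq p g Y) ≤ Y`. [folklore] -/
theorem card_primesModEq_le (p : ℕ) (g : ZMod p) (Y : ℕ) : (primesModEq p g Y).card ≤ Y := by
  have hsub : primesModEq p g Y ⊆ Finset.Icc 1 Y := by
    intro q hq
    rw [mem_primesModEq] at hq
    simp only [Finset.mem_Icc]
    exact ⟨hq.2.1.one_lt.le, hq.1⟩
  refine le_trans (Finset.card_le_card hsub) ?_
  simp

/-- `gcd(p v^{p-1}, (p−1) u^p) = 1` when `u, v` are coprime, `p ∤ u` and all prime factors of `v`
exceed `p`. [folklore] -/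
theorem coprime_masserA_masserB {p u v : ℕ} (hprime : p.Prime) (hcop : Nat.Coprime u v)
    (hpu : ¬ p ∣ u) (hv : ∀ q : ℕ, q.Prime → q ∣ v → p < q) :
    Nat.Coprime (masserA p v) (masserB p u) := by
  have hp : 2 ≤ p := hprime.two_le
  unfold masserA masserB
  have h1 : Nat.Coprime p (p - 1) :=
    (Nat.Prime.coprime_iff_not_dvd hprime).mpr (fun h => by have := Nat.le_of_dvd (by omega) h; omega)
  have h2 : Nat.Coprime p (u ^ p) := Nat.Coprime.pow_right _ ((Nat.Prime.coprime_iff_not_dvd hprime).mpr hpu)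
  have h3 : Nat.Coprime v (p - 1) := by
    apply Nat.coprime_of_dvd
    intro q hq hqv hqp
    have := hv q hq hqv
    have := Nat.le_of_dvd (by omega) hqp
    omega
  have h4 : Nat.Coprime v u := hcop.symm
  apply Nat.Coprime.mul_left
  · exact Nat.Coprime.mul_right h1 h2
  · apply Nat.Coprime.pow_left
    exact Nat.Coprime.mul_right h3 (Nat.Coprime.pow_right _ h4)

/-- **Masser's theorem in prime base degree `p ≥ 3`, deterministic part.**
[cite: Masser2002, §3 (3.4)–(3.10)] -/
theorem prime_assembly {p e : ℕ} (hprime : p.Prime) (hp3 : 3 ≤ p) {g : ZMod p}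
    (hg : ∀ f : ℕ, 0 < f → g ^ f = 1 → p - 1 ≤ f)
    (he : 1 ≤ e) (l ν C : ℝ) (hl : 1 ≤ l) {Y E T : ℕ}
    (hY : 2 ≤ Y) (hE : 1 ≤ E) (hk : 1 ≤ (primesModEq p g Y).card)
    (hT : Real.log (2 * ((p * (p - 1) : ℕ) : ℝ)) +
      ((p * (p - 1) : ℕ) : ℝ) * ((Y : ℝ) * E * Real.log Y) < θ (T : ℝ))
    (hneed : Real.log C +
        ((Real.log 3) ^ ν +
          ((p * e : ℕ) * Real.log (p * e : ℕ) + (p * e : ℕ) * Real.log (2 * (T : ℝ)) +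
            e * Real.log (masserH p) +
            e * ((p * (p - 1) : ℕ) : ℝ) * ((Y : ℝ) * E * Real.log Y)) ^ ν) / Real.log (Real.log 3) +
        (p * e : ℕ) * Real.log (p * e : ℕ) + (p * e : ℕ) * Real.log (2 * (T : ℝ)) +
        e * Real.log (masserH p) + e * Real.log 2 + 2 * e * Real.log (2 * (Y : ℝ)) +
        l * (p * e : ℕ) * (Real.log (primorial p) + (primesModEq p g Y).card * Real.log Y) <
        e * ((primesModEq p g Y).card * Real.log ((E : ℝ) + 1))) :
    ∃ (K : Type) (_ : Field K) (_ : NumberField K),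
      Module.finrank ℚ K = p * e ∧
        ∃ a b c : K, a ≠ 0 ∧ b ≠ 0 ∧ c ≠ 0 ∧ a + b + c = 0 ∧
          C * |(NumberField.discr K : ℝ)| * masserPhi ν |(NumberField.discr K : ℝ)| *
              (masserSupport a b c : ℝ) ^ l <
            mulHeight ![a, b, c] := by
  classical
  have hp : 2 ≤ p := by omega
  set P := primesModEq p g Y with hPdef
  have hPprime : ∀ q ∈ P, q.Prime := fun q hq => (mem_primesModEq.mp hq).2.1
  have hPY : ∀ q ∈ P, q ≤ Y := fun q hq => (mem_primesModEq.mp hq).1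
  have hPp : ∀ q ∈ P, q.Prime ∧ p < q := fun q hq => ⟨(mem_primesModEq.mp hq).2.1, (mem_primesModEq.mp hq).2.2.1⟩
  have hkY : P.card ≤ Y := card_primesModEq_le p g Y
  have hB : 2 ≤ (E + 1) ^ P.card :=
    calc 2 ≤ E + 1 := by omega
      _ = (E + 1) ^ 1 := (pow_one _).symm
      _ ≤ (E + 1) ^ P.card := Nat.pow_le_pow_right (by omega) hk
  obtain ⟨m, hmprime, hYm, hm2Y⟩ := Nat.exists_prime_lt_and_le_two_mul Y (by omega)
  have hQpos : 0 < m ^ Nat.log m ((E + 1) ^ P.card - 1) := pow_pos hmprime.pos _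
  have hQlt : m ^ Nat.log m ((E + 1) ^ P.card - 1) < (E + 1) ^ P.card := by
    have := Nat.pow_log_le_self m (show (E + 1) ^ P.card - 1 ≠ 0 by omega)
    omega
  have hQP : ∀ q ∈ P, ¬ q ∣ m ^ Nat.log m ((E + 1) ^ P.card - 1) := by
    intro q hq hdvd
    have hqm : q ∣ m := (hPprime q hq).dvd_of_dvd_pow hdvd
    have := (Nat.prime_dvd_prime_iff_eq (hPprime q hq) hmprime).mp hqm
    have := hPY q hq
    omega
  obtain ⟨u, v, hu, huv, hvle, hcop, hsmooth, hQdvd⟩ :=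
    exists_coprime_smooth_pair hPprime hPY hQpos hQP hQlt
  have hv : 0 < v := lt_trans hu huv
  have hMpos : 0 < m ^ (Nat.log m ((E + 1) ^ P.card - 1) / 2) := pow_pos hmprime.pos _
  have hMdvd := sq_pow_half_dvd' hQdvd
  -- `gcd(A, B) = 1`
  have hpu : ¬ p ∣ u := by
    intro hdvd
    have := (hPp p (hsmooth p hprime (Dvd.dvd.mul_right hdvd v))).2
    omega
  have hvP : ∀ q : ℕ, q.Prime → q ∣ v → p < q := fun q hq hqv =>
    (hPp q (hsmooth q hq (Dvd.dvd.mul_left hqv u))).2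
  have hcop2 : Nat.Coprime (masserA p v) (masserB p u) := coprime_masserA_masserB hprime hcop hpu hvP
  -- the prime `ℓ ∣ v` of order `p − 1` mod `p`
  set ℓ := v.minFac with hℓdef
  have hv1 : v ≠ 1 := by omega
  have hℓ : ℓ.Prime := Nat.minFac_prime hv1
  have hℓv : ℓ ∣ v := Nat.minFac_dvd v
  have hℓP : ℓ ∈ P := hsmooth ℓ hℓ (Dvd.dvd.mul_left hℓv u)
  have hpℓ : p < ℓ := (hPp ℓ hℓP).2
  have hℓg : (ℓ : ZMod p) = g := (mem_primesModEq.mp hℓP).2.2.2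
  have hord : ∀ f : ℕ, 0 < f → ((ℓ : ZMod p)) ^ f = 1 → p - 1 ≤ f := by
    intro f hf h1; rw [hℓg] at h1; exact hg f hf h1
  have hℓu : ¬ ℓ ∣ u := by
    intro hℓu
    have := (Nat.Coprime.coprime_dvd_left hℓu hcop).eq_one_of_dvd hℓv
    exact hℓ.one_lt.ne' this
  -- the auxiliary prime `r`
  have hNpos : 0 < p * (p - 1) := Nat.mul_pos (by omega) (by omega)
  have huvN : u ^ (p * (p - 1)) < v ^ (p * (p - 1)) := Nat.pow_lt_pow_left huv hNpos.ne'
  have hDpos : 0 < p * (p - 1) * (v ^ (p * (p - 1)) - u ^ (p * (p - 1))) := Nat.mul_pos hNpos (by omega)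
  have hYR : (1 : ℝ) < Y := by exact_mod_cast (show 1 < Y by omega)
  have hlogY : 0 < Real.log Y := Real.log_pos hYR
  have hlogv : Real.log v ≤ (Y : ℝ) * E * Real.log Y := by
    have h1 : (v : ℝ) ≤ (Y : ℝ) ^ (P.card * E) := by exact_mod_cast hvle
    calc Real.log v ≤ Real.log ((Y : ℝ) ^ (P.card * E)) :=
          Real.log_le_log (by exact_mod_cast hv) h1
      _ = (P.card * E : ℕ) * Real.log Y := by rw [Real.log_pow]
      _ ≤ (Y : ℝ) * E * Real.log Y := by
          apply mul_le_mul_of_nonneg_right _ hlogY.le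
          have : ((P.card * E : ℕ) : ℝ) ≤ ((Y * E : ℕ) : ℝ) := by
            exact_mod_cast Nat.mul_le_mul_right E hkY
          push_cast at this ⊢; exact this
  have hθT : Real.log (2 * ((p * (p - 1) * (v ^ (p * (p - 1)) - u ^ (p * (p - 1))) : ℕ) : ℝ)) <
      θ (T : ℝ) := by
    refine lt_of_le_of_lt ?_ hT
    have hNR : (0 : ℝ) < ((p * (p - 1) : ℕ) : ℝ) := by exact_mod_cast hNpos
    have h1 : ((p * (p - 1) * (v ^ (p * (p - 1)) - u ^ (p * (p - 1))) : ℕ) : ℝ) ≤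
        ((p * (p - 1) : ℕ) : ℝ) * (v : ℝ) ^ (p * (p - 1)) := by
      have : p * (p - 1) * (v ^ (p * (p - 1)) - u ^ (p * (p - 1))) ≤ p * (p - 1) * v ^ (p * (p - 1)) :=
        Nat.mul_le_mul_left _ (Nat.sub_le _ _)
      exact_mod_cast this
    have hvR : (0 : ℝ) < v := by exact_mod_cast hv
    calc Real.log (2 * ((p * (p - 1) * (v ^ (p * (p - 1)) - u ^ (p * (p - 1))) : ℕ) : ℝ))
        ≤ Real.log (2 * (((p * (p - 1) : ℕ) : ℝ) * (v : ℝ) ^ (p * (p - 1)))) := by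
          apply Real.log_le_log (by positivity)
          linarith
      _ = Real.log (2 * ((p * (p - 1) : ℕ) : ℝ)) + ((p * (p - 1) : ℕ) : ℝ) * Real.log v := by
          rw [← mul_assoc, Real.log_mul (by positivity) (by positivity), Real.log_pow]
      _ ≤ Real.log (2 * ((p * (p - 1) : ℕ) : ℝ)) + ((p * (p - 1) : ℕ) : ℝ) * ((Y : ℝ) * E * Real.log Y) := by
          have := mul_le_mul_of_nonneg_left hlogv hNR.le
          linarith
  obtain ⟨r, hr, -, hrT, hrdvd⟩ := exists_odd_prime_not_dvd hDpos hθT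
  -- the field
  obtain ⟨L, iF, iN, hfin, hD, a, b, c, ha, hb, hc, habc, hH, hS⟩ :=
    exists_field_prime_core (e := e) (r := r) hprime hp3 hu huv hcop2 hℓ hℓv hpℓ hℓu hord
      hMpos.ne' hMdvd he hr hrdvd
  refine ⟨L, iF, iN, hfin, a, b, c, ha, hb, hc, habc, ?_⟩
  exact prime_final_step hp he l ν C hl hY hPY hPp hneed hmprime hm2Y hB hv hsmooth hrT hr hfin hD
    hH hS hlogv hMpos

end PrimeAssembly

/-! ### Dirichlet input: many primes `≡ g (mod p)` below `Y`, for infinitely many `Y` -/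

section PrimesInClass

open Filter ArithmeticFunction

/-- Pure bookkeeping: from `q ≥ b > 0` and `δ ∈ (0,1)`, `log q / q ≤ b^{δ-1}/δ`. [folklore] -/
theorem log_div_self_le_rpow {q b δ : ℝ} (hb : 0 < b) (hbq : b ≤ q) (hδ : 0 < δ) (hδ1 : δ < 1) :
    Real.log q / q ≤ b ^ (δ - 1) / δ := by
  have hq : 0 < q := lt_of_lt_of_le hb hbq
  have h1 : Real.log q ≤ q ^ δ / δ := Real.log_le_rpow_div hq.le hδ
  calc Real.log q / q ≤ (q ^ δ / δ) / q := div_le_div_of_nonneg_right h1 hq.le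
    _ = q ^ (δ - 1) / δ := by
        rw [Real.rpow_sub_one hq.ne']
        field_simp
    _ ≤ b ^ (δ - 1) / δ := by
        apply div_le_div_of_nonneg_right _ hδ.le
        exact Real.rpow_le_rpow_of_nonpos hb hbq (by linarith)

/-- **Dirichlet's theorem, counting form along a subsequence.** For a unit `g` mod `p`, `0 < c < 1`
and `C₀ > 0` there are arbitrarily large `Y` with `#{q prime : p < q ≤ Y, q ≡ g (p)} ≥ C₀ Y^c`.
(Otherwise the `i`-th such prime `q_i` would satisfy `q_i ≫ i^{1/c}`, making
`Σ log q_i / q_i` converge, contradicting Mathlib's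
`ArithmeticFunction.vonMangoldt.not_summable_residueClass_prime_div`.) [folklore] -/
theorem exists_card_primesModEq_ge {p : ℕ} [NeZero p] {g : ZMod p} (hg : IsUnit g)
    {c : ℝ} (hc0 : 0 < c) (hc1 : c < 1) {C₀ : ℝ} (hC₀ : 0 < C₀) (y₀ : ℕ) :
    ∃ Y : ℕ, y₀ ≤ Y ∧ C₀ * (Y : ℝ) ^ c ≤ ((primesModEq p g Y).card : ℝ) := by
  classical
  by_contra hcon
  push Not at hcon
  set Pr : ℕ → Prop := fun q => q.Prime ∧ (q : ZMod p) = g with hPr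
  have hinf : (setOf Pr).Infinite := Nat.infinite_setOf_prime_and_eq_mod hg
  -- counting: `count Pr (Y+1) ≤ #primesModEq p g Y + (p + 1)`
  have hcount : ∀ Y : ℕ, Nat.count Pr (Y + 1) ≤ (primesModEq p g Y).card + (p + 1) := by
    intro Y
    rw [Nat.count_eq_card_filter_range]
    have hsub : (Finset.range (Y + 1)).filter Pr ⊆ primesModEq p g Y ∪ Finset.range (p + 1) := by
      intro q hq
      rw [Finset.mem_filter, Finset.mem_range] at hq
      rw [Finset.mem_union, mem_primesModEq, Finset.mem_range]
      by_cases hpq : p < q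
      · exact Or.inl ⟨by omega, hq.2.1, hpq, hq.2.2⟩
      · exact Or.inr (by omega)
    calc ((Finset.range (Y + 1)).filter Pr).card ≤ (primesModEq p g Y ∪ Finset.range (p + 1)).card :=
          Finset.card_le_card hsub
      _ ≤ (primesModEq p g Y).card + (Finset.range (p + 1)).card := Finset.card_union_le _ _
      _ = (primesModEq p g Y).card + (p + 1) := by rw [Finset.card_range]
  -- the enumeration `q_i = nth Pr i`
  set nth := Nat.nth Pr with hnth
  have hmono : StrictMono nth := Nat.nth_strictMono hinf
  have hnth_mem : ∀ i, Pr (nth i) := fun i => Nat.nth_mem_of_infinite hinf i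
  have hile : ∀ i, i ≤ nth i := fun i => hmono.id_le i
  have hcnt : ∀ i, Nat.count Pr (nth i + 1) = i + 1 := by
    intro i
    rw [Nat.count_succ, hnth, Nat.count_nth_of_infinite hinf, if_pos (hnth_mem i)]
  -- for `i ≥ y₀`: `i < C₀ q_i^c + p`
  have hi_lt : ∀ i : ℕ, y₀ ≤ i → (i : ℝ) < C₀ * ((nth i : ℕ) : ℝ) ^ c + p := by
    intro i hi
    have hY : y₀ ≤ nth i := le_trans hi (hile i)
    have h1 := hcon (nth i) hY
    have h2 := hcount (nth i)
    rw [hcnt i] at h2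
    have h3 : ((i + 1 : ℕ) : ℝ) ≤ (((primesModEq p g (nth i)).card + (p + 1) : ℕ) : ℝ) := by
      exact_mod_cast h2
    push_cast at h3
    linarith
  -- hence `q_i ≥ (i/(2C₀))^{1/c}` for `i ≥ max y₀ (2p)`
  set i₀ : ℕ := max y₀ (2 * p + 1) with hi₀
  have hq_ge : ∀ i : ℕ, i₀ ≤ i → ((i : ℝ) / (2 * C₀)) ^ (1 / c) ≤ ((nth i : ℕ) : ℝ) := by
    intro i hi
    have hiy : y₀ ≤ i := le_trans (le_max_left _ _) hi
    have hip : 2 * p + 1 ≤ i := le_trans (le_max_right _ _) hi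
    have h1 := hi_lt i hiy
    have hipR : (2 * p + 1 : ℝ) ≤ i := by exact_mod_cast hip
    have h2 : (i : ℝ) / (2 * C₀) ≤ ((nth i : ℕ) : ℝ) ^ c := by
      rw [div_le_iff₀ (by positivity)]
      nlinarith
    have h3 : 0 ≤ (i : ℝ) / (2 * C₀) := by positivity
    calc ((i : ℝ) / (2 * C₀)) ^ (1 / c) ≤ (((nth i : ℕ) : ℝ) ^ c) ^ (1 / c) :=
          Real.rpow_le_rpow h3 h2 (by positivity)
      _ = ((nth i : ℕ) : ℝ) := by
          rw [← Real.rpow_mul (Nat.cast_nonneg _), mul_one_div_cancel hc0.ne', Real.rpow_one]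
  -- the divergent series of Mathlib, and its values on the `q_i`
  set F : ℕ → ℝ := fun n => (if n.Prime then vonMangoldt.residueClass g n else 0) / n with hF
  have hFsupp : ∀ n ∉ Set.range nth, F n = 0 := by
    intro n hn
    rw [hnth, Nat.range_nth_of_infinite hinf] at hn
    have : n ∉ Function.support F := by
      rw [hF, vonMangoldt.support_residueClass_prime_div]
      exact hn
    simpa [Function.mem_support] using this
  have hFnth : ∀ i, F (nth i) = Real.log (nth i) / (nth i) := by
    intro i
    obtain ⟨hpr, hmod⟩ := hnth_mem i
    simp only [hF, hpr, if_true, vonMangoldt.residueClass, Set.indicator_apply, Set.mem_setOf_eq,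
      hmod, vonMangoldt_apply_prime hpr]
  -- summability of `F ∘ nth` by comparison with `K i^{-s}`, `s = (1+c)/(2c) > 1`
  set δ : ℝ := (1 - c) / 2 with hδ
  have hδ0 : 0 < δ := by rw [hδ]; linarith
  have hδ1 : δ < 1 := by rw [hδ]; linarith
  set s : ℝ := (1 - δ) / c with hs
  have hs1 : 1 < s := by
    rw [hs, lt_div_iff₀ hc0, hδ]; linarith
  set K : ℝ := (1 / (2 * C₀)) ^ ((δ - 1) / c) / δ with hK
  have hbound : ∀ i : ℕ, i₀ ≤ i → F (nth i) ≤ K * (i : ℝ) ^ (-s) := by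
    intro i hi
    have hipos : (0 : ℝ) < i := by
      have : 2 * p + 1 ≤ i := le_trans (le_max_right _ _) hi
      exact_mod_cast (show 0 < i by omega)
    have hb : 0 < ((i : ℝ) / (2 * C₀)) ^ (1 / c) := by positivity
    rw [hFnth i]
    refine le_trans (log_div_self_le_rpow hb (hq_ge i hi) hδ0 hδ1) (le_of_eq ?_)
    rw [← Real.rpow_mul (by positivity), div_eq_mul_one_div (i : ℝ) (2 * C₀),
      Real.mul_rpow hipos.le (by positivity), hK, hs]
    have : (1 : ℝ) / c * (δ - 1) = -((1 - δ) / c) := by ring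
    rw [this]
    have : (δ - 1) / c = -((1 - δ) / c) := by ring
    rw [this]
    ring
  have hsumm_nth : Summable (F ∘ nth) := by
    have hg : Summable (fun i : ℕ => K * (i : ℝ) ^ (-s)) :=
      (Real.summable_nat_rpow.mpr (by linarith)).mul_left K
    refine Summable.of_norm_bounded_eventually_nat hg ?_
    filter_upwards [eventually_ge_atTop i₀] with i hi
    rw [Function.comp_apply, Real.norm_of_nonneg]
    · exact hbound i hi
    · rw [hFnth]
      have := (hnth_mem i).1.one_lt
      exact div_nonneg (Real.log_nonneg (by exact_mod_cast this.le)) (Nat.cast_nonneg _)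
  have hsumm : Summable F := (hmono.injective.summable_iff hFsupp).mp hsumm_nth
  exact vonMangoldt.not_summable_residueClass_prime_div hg hsumm

end PrimesInClass

/-! ### Choice of the parameters and Masser's theorem in prime base degree, hence in every degree -/

section PrimeMain

open Filter Asymptotics Topology Chebyshev Finset

/-- Choice of the slack `σ > 0` with `ν (pλ + 2σ + 1) < 1` (possible as `ν < 1/(pλ+1)`).
[folklore] -/
theorem exists_slackP {P l ν : ℝ} (hP : 1 ≤ P) (hl : 1 ≤ l) (hν : ν < 1 / (P * l + 1)) :
    ∃ σ : ℝ, 0 < σ ∧ ν * (P * l + 2 * σ + 1) < 1 := by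
  have hPl : 1 ≤ P * l := by nlinarith
  rcases le_or_gt ν 0 with h | h
  · refine ⟨1, one_pos, ?_⟩
    have : ν * (P * l + 2 * 1 + 1) ≤ 0 := mul_nonpos_of_nonpos_of_nonneg h (by linarith)
    linarith
  · have hpos : (0 : ℝ) < P * l + 1 := by linarith
    have h1 : ν * (P * l + 1) < 1 := by
      rw [lt_div_iff₀ hpos] at hν; linarith
    refine ⟨(1 - ν * (P * l + 1)) / (4 * ν), by positivity, ?_⟩
    have : ν * (P * l + 2 * ((1 - ν * (P * l + 1)) / (4 * ν)) + 1) =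
        ν * (P * l + 1) + (1 - ν * (P * l + 1)) / 2 := by
      field_simp
      ring
    rw [this]
    linarith

/-- For `ν (a+1) < c`: `(A y^{a+1} log y)^ν = o(y^c)`. [folklore] -/
theorem isLittleO_rpow_main' {A a ν c : ℝ} (hA : 0 ≤ A) (hνa : ν * (a + 1) < c) (hc : 0 < c) :
    (fun y : ℝ => (A * y ^ (a + 1) * Real.log y) ^ ν) =o[atTop] (fun y => y ^ c) := by
  set s : ℝ := c - ν * (a + 1) with hs
  have hspos : 0 < s := by rw [hs]; linarith
  have h1 : (fun y : ℝ => Real.log y ^ ν) =o[atTop] (fun y => y ^ s) :=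
    isLittleO_log_rpow_rpow_atTop ν hspos
  have h2 : (fun y : ℝ => (A ^ ν * y ^ (ν * (a + 1))) * Real.log y ^ ν) =o[atTop]
      (fun y => (A ^ ν * y ^ (ν * (a + 1))) * y ^ s) :=
    (isBigO_refl (fun y : ℝ => A ^ ν * y ^ (ν * (a + 1))) atTop).mul_isLittleO h1
  have h3 : (fun y : ℝ => (A * y ^ (a + 1) * Real.log y) ^ ν) =ᶠ[atTop]
      (fun y => (A ^ ν * y ^ (ν * (a + 1))) * Real.log y ^ ν) := by
    filter_upwards [eventually_ge_atTop (1 : ℝ)] with y hy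
    have hy0 : 0 ≤ y := by linarith
    have hlog : 0 ≤ Real.log y := Real.log_nonneg hy
    rw [Real.mul_rpow (by positivity) hlog, Real.mul_rpow hA (by positivity), ← Real.rpow_mul hy0,
      mul_comm (a + 1) ν]
  have h4 : (fun y : ℝ => (A ^ ν * y ^ (ν * (a + 1))) * y ^ s) =O[atTop] (fun y => y ^ c) := by
    apply IsBigO.of_bound (A ^ ν)
    filter_upwards [eventually_ge_atTop (0 : ℝ)] with y hy
    have hsum : ν * (a + 1) + s = c := by rw [hs]; ring
    rw [mul_assoc, ← Real.rpow_add' hy (by rw [hsum]; exact hc.ne'), Real.norm_of_nonneg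
      (Real.rpow_nonneg hy c), Real.norm_of_nonneg (by positivity), hsum]
  exact (h3.trans_isLittleO h2).trans_isBigO h4

/-- The error function of the final inequality is `o(y^c)` when `ν(a+1) < c`, `0 < c`.
[folklore] -/
theorem isLittleO_errorFun' {J B A a ν c₀ c : ℝ} (hA : 0 < A) (ha : 0 < a + 1)
    (hνa : ν * (a + 1) < c) (hc : 0 < c) :
    (fun y : ℝ => J + B * Real.log y + (A * y ^ (a + 1) * Real.log y) ^ ν / c₀) =o[atTop]
      (fun y => y ^ c) := by
  have hconst : ∀ K : ℝ, (fun _ : ℝ => K) =o[atTop] (fun y : ℝ => y ^ c) := by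
    intro K
    refine isLittleO_const_left.mpr (Or.inr ?_)
    exact tendsto_norm_atTop_atTop.comp (tendsto_rpow_atTop hc)
  refine ((hconst J).add ?_).add ?_
  · exact ((isLittleO_log_rpow_atTop hc).const_mul_left B)
  · simp_rw [div_eq_inv_mul]
    apply IsLittleO.const_mul_left
    rcases le_or_gt ν 0 with hν | hν
    · -- for `ν ≤ 0` the term is eventually `≤ 1`
      have hbase : Tendsto (fun y : ℝ => A * y ^ (a + 1) * Real.log y) atTop atTop := by
        have h1 : Tendsto (fun y : ℝ => A * y ^ (a + 1)) atTop atTop :=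
          (tendsto_rpow_atTop ha).const_mul_atTop hA
        exact h1.atTop_mul_atTop₀ Real.tendsto_log_atTop
      have hev : ∀ᶠ y in atTop, ‖(A * y ^ (a + 1) * Real.log y) ^ ν‖ ≤ 1 * ‖(1 : ℝ)‖ := by
        filter_upwards [hbase.eventually_ge_atTop 1] with y hy
        rw [Real.norm_of_nonneg (Real.rpow_nonneg (by linarith) ν), norm_one, one_mul]
        exact Real.rpow_le_one_of_one_le_of_nonpos hy hν
      exact (IsBigO.of_bound 1 hev).trans_isLittleO (hconst 1)
    · exact isLittleO_rpow_main' hA.le hνa hc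

/-- The final linear bookkeeping for the choice of parameters in prime base degree. [folklore] -/
theorem prime_need_arith {logC L3ν c₀ Pν Λν J B Y logY log2T log2K θp lognR loghR kR kL kE Yc
    e a l σ p nR : ℝ}
    (hnR : nR = p * e) (ha : a = p * l + 2 * σ)
    (hJ : J = logC + (L3ν + 1) / c₀ + nR * lognR + nR * log2K + e * loghR + e * Real.log 2 +
      2 * e * Real.log 2 + l * nR * θp)
    (hB : B = nR * (a + 2) + 2 * e)
    (hlog2Y : Real.log (2 * Y) = Real.log 2 + logY)
    (hfracle : (L3ν + Λν) / c₀ ≤ (L3ν + 1) / c₀ + Pν / c₀)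
    (hErr : J + B * logY + Pν / c₀ ≤ e * σ * Yc)
    (hYc : e * σ * Yc ≤ e * σ * kR)
    (hk1 : e * σ * kR < 2 * (e * σ) * kL)
    (hkE : e * a * kL ≤ e * kE)
    (hkL : kL = kR * logY)
    (h2T : nR * log2T ≤ nR * (log2K + (a + 2) * logY)) :
    logC + (L3ν + Λν) / c₀ + nR * lognR + nR * log2T + e * loghR + e * Real.log 2 +
      2 * e * Real.log (2 * Y) + l * nR * (θp + kR * logY) < e * kE := by
  subst hnR ha hJ hB hkL
  rw [hlog2Y]
  linarith [hfracle, hErr, hYc, hk1, hkE, h2T]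

/-- `h_p ≥ 4` for `p ≥ 2`. [folklore] -/
theorem four_le_masserH {p : ℕ} (hp : 2 ≤ p) : 4 ≤ masserH p := by
  unfold masserH
  calc 4 = 2 ^ 2 * 1 := by norm_num
    _ ≤ p ^ p * (p - 1) ^ (p - 1) := by
        apply Nat.mul_le_mul
        · exact le_trans (Nat.pow_le_pow_left hp 2) (Nat.pow_le_pow_right (by omega) hp)
        · exact Nat.one_le_pow _ _ (by omega)

/-- Elementary bounds for the parameter choice in prime base degree. [folklore] -/
theorem param_boundsP {p e : ℕ} (hp : 2 ≤ p) (he : 1 ≤ e) {a KT : ℝ} (ha0 : 0 < a) (hKT : 5 ≤ KT)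
    {Y E T : ℕ} (hY3 : 3 ≤ Y)
    (hEle : (E : ℝ) ≤ (Y : ℝ) ^ a) (hTK : (T : ℝ) ≤ KT * (Y : ℝ) ^ (a + 2)) (hT1 : (1 : ℝ) ≤ T) :
    Real.log (2 * (T : ℝ)) ≤ Real.log (2 * KT) + (a + 2) * Real.log Y ∧
    (1 : ℝ) ≤ (p * e : ℕ) * Real.log (p * e : ℕ) + (p * e : ℕ) * Real.log (2 * (T : ℝ)) +
      e * Real.log (masserH p) + e * ((p * (p - 1) : ℕ) : ℝ) * ((Y : ℝ) * E * Real.log Y) ∧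
    ((p * e : ℕ) * Real.log (p * e : ℕ) + (p * e : ℕ) * Real.log (2 * (T : ℝ)) +
      e * Real.log (masserH p) + e * ((p * (p - 1) : ℕ) : ℝ) * ((Y : ℝ) * E * Real.log Y) ≤
      ((p * e : ℕ) * Real.log (p * e : ℕ) + (p * e : ℕ) * Real.log (2 * KT) + e * Real.log (masserH p) +
        (p * e : ℕ) * (a + 2) + e * ((p * (p - 1) : ℕ) : ℝ)) * (Y : ℝ) ^ (a + 1) * Real.log Y) := by
  set nR : ℝ := ((p * e : ℕ) : ℝ) with hnRdef
  set NR : ℝ := ((p * (p - 1) : ℕ) : ℝ) with hNRdef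
  set hR : ℝ := (masserH p : ℝ) with hhRdef
  have hYR : (3 : ℝ) ≤ Y := by exact_mod_cast hY3
  have hY1 : (1 : ℝ) ≤ Y := by linarith
  have hY0 : (0 : ℝ) < Y := by linarith
  have heR : (1 : ℝ) ≤ e := by exact_mod_cast he
  have hn1 : 1 ≤ p * e := Nat.one_le_iff_ne_zero.mpr (Nat.mul_ne_zero (by omega) (by omega))
  have hnR1 : (1 : ℝ) ≤ nR := by rw [hnRdef]; exact_mod_cast hn1
  have hNR0 : (0 : ℝ) ≤ NR := by rw [hNRdef]; exact Nat.cast_nonneg _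
  have hlogY1 : 1 ≤ Real.log Y := by
    rw [Real.le_log_iff_exp_le hY0]
    have := Real.exp_one_lt_d9; linarith
  have hlogY0 : 0 < Real.log Y := by linarith
  have hlogn : 0 ≤ Real.log nR := Real.log_nonneg hnR1
  have hlog2K : 0 < Real.log (2 * KT) := Real.log_pos (by linarith)
  have hloghR : 0 ≤ Real.log hR := by
    have h4 : (4 : ℝ) ≤ hR := by rw [hhRdef]; exact_mod_cast four_le_masserH hp
    exact Real.log_nonneg (by linarith)
  have hnlogn : 1 ≤ nR * Real.log nR := by
    have hnR2 : (2 : ℝ) ≤ nR := by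
      rw [hnRdef]; exact_mod_cast le_trans hp (Nat.le_mul_of_pos_right p (by omega))
    have hl2 : Real.log 2 ≤ Real.log nR := Real.log_le_log (by norm_num) hnR2
    have := Real.log_two_gt_d9
    nlinarith
  have hlog2T : Real.log (2 * (T : ℝ)) ≤ Real.log (2 * KT) + (a + 2) * Real.log Y := by
    rw [← Real.log_rpow hY0, ← Real.log_mul (by positivity) (by positivity)]
    exact Real.log_le_log (by positivity) (by nlinarith)
  have hlog2T0 : 0 ≤ Real.log (2 * (T : ℝ)) := Real.log_nonneg (by linarith)
  have hYa1' : (1 : ℝ) ≤ (Y : ℝ) ^ (a + 1) := Real.one_le_rpow hY1 (by linarith)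
  have hYEl : (Y : ℝ) * E * Real.log Y ≤ (Y : ℝ) ^ (a + 1) * Real.log Y := by
    apply mul_le_mul_of_nonneg_right _ hlogY0.le
    calc (Y : ℝ) * E ≤ (Y : ℝ) * (Y : ℝ) ^ a := mul_le_mul_of_nonneg_left hEle hY0.le
      _ = (Y : ℝ) ^ (a + 1) := by
          rw [Real.rpow_add hY0, Real.rpow_one]; ring
  set W := (Y : ℝ) ^ (a + 1) * Real.log Y with hW
  have hW1 : 1 ≤ W := by rw [hW]; nlinarith
  have hW0 : 0 ≤ W := by linarith
  have hYE0 : 0 ≤ (Y : ℝ) * E * Real.log Y := by positivity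
  refine ⟨hlog2T, ?_, ?_⟩
  · have : 0 ≤ nR * Real.log (2 * (T : ℝ)) := by positivity
    have : 0 ≤ (e : ℝ) * NR * ((Y : ℝ) * E * Real.log Y) := by positivity
    have : 0 ≤ (e : ℝ) * Real.log hR := by positivity
    linarith
  · have t1 : nR * Real.log nR ≤ nR * Real.log nR * W := le_mul_of_one_le_right (by positivity) hW1
    have t21 : nR * Real.log (2 * KT) ≤ nR * Real.log (2 * KT) * W :=
      le_mul_of_one_le_right (by positivity) hW1
    have t22 : (a + 2) * Real.log Y ≤ (a + 2) * W := by
      apply mul_le_mul_of_nonneg_left _ (by linarith)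
      rw [hW]; exact le_mul_of_one_le_left hlogY0.le hYa1'
    have t2 : nR * Real.log (2 * (T : ℝ)) ≤ nR * Real.log (2 * KT) * W + nR * (a + 2) * W := by
      have := mul_le_mul_of_nonneg_left hlog2T (show (0 : ℝ) ≤ nR by positivity)
      have := mul_le_mul_of_nonneg_left t22 (show (0 : ℝ) ≤ nR by positivity)
      linarith
    have t3 : (e : ℝ) * Real.log hR ≤ e * Real.log hR * W :=
      le_mul_of_one_le_right (by positivity) hW1
    have t4 : (e : ℝ) * NR * ((Y : ℝ) * E * Real.log Y) ≤ e * NR * W :=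
      mul_le_mul_of_nonneg_left hYEl (by positivity)
    have hexp : (nR * Real.log nR + nR * Real.log (2 * KT) + e * Real.log hR + nR * (a + 2) + e * NR) *
        (Y : ℝ) ^ (a + 1) * Real.log Y =
        nR * Real.log nR * W + nR * Real.log (2 * KT) * W + e * Real.log hR * W + nR * (a + 2) * W +
          e * NR * W := by
      rw [hW]; ring
    rw [hexp]
    linarith

set_option maxHeartbeats 800000 in
/-- **Existence of good parameters** `Y, E, T` for the assembly in prime base degree `p ≥ 3`
(along the subsequence of `Y` provided by Dirichlet's theorem).
[cite: Masser2002, §3, Lemma and (3.10)] -/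
theorem exists_good_params_prime {p e : ℕ} (hprime : p.Prime) (hp3 : 3 ≤ p) {g : ZMod p}
    (hgu : IsUnit g) (he : 1 ≤ e) (l ν C : ℝ) (hl : 1 ≤ l) (hν : ν < 1 / (p * l + 1)) :
    ∃ Y E T : ℕ, 2 ≤ Y ∧ 1 ≤ E ∧ 1 ≤ (primesModEq p g Y).card ∧
      Real.log (2 * ((p * (p - 1) : ℕ) : ℝ)) +
        ((p * (p - 1) : ℕ) : ℝ) * ((Y : ℝ) * E * Real.log Y) < θ (T : ℝ) ∧
      Real.log C +
        ((Real.log 3) ^ ν +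
          ((p * e : ℕ) * Real.log (p * e : ℕ) + (p * e : ℕ) * Real.log (2 * (T : ℝ)) +
            e * Real.log (masserH p) +
            e * ((p * (p - 1) : ℕ) : ℝ) * ((Y : ℝ) * E * Real.log Y)) ^ ν) / Real.log (Real.log 3) +
        (p * e : ℕ) * Real.log (p * e : ℕ) + (p * e : ℕ) * Real.log (2 * (T : ℝ)) +
        e * Real.log (masserH p) + e * Real.log 2 + 2 * e * Real.log (2 * (Y : ℝ)) +
        l * (p * e : ℕ) * (Real.log (primorial p) + (primesModEq p g Y).card * Real.log Y) <
        e * ((primesModEq p g Y).card * Real.log ((E : ℝ) + 1)) := by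
  haveI : NeZero p := ⟨hprime.ne_zero⟩
  have hp : 2 ≤ p := by omega
  set nR : ℝ := ((p * e : ℕ) : ℝ) with hnRdef
  set NR : ℝ := ((p * (p - 1) : ℕ) : ℝ) with hNRdef
  set hR : ℝ := (masserH p : ℝ) with hhRdef
  set θp : ℝ := Real.log (primorial p) with hθpdef
  have hpR : (3 : ℝ) ≤ p := by exact_mod_cast hp3
  have heR : (1 : ℝ) ≤ e := by exact_mod_cast he
  have hn1 : 1 ≤ p * e := Nat.one_le_iff_ne_zero.mpr (Nat.mul_ne_zero (by omega) (by omega))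
  have hnR1 : (1 : ℝ) ≤ nR := by rw [hnRdef]; exact_mod_cast hn1
  have hnRpe : nR = (p : ℝ) * e := by rw [hnRdef]; push_cast; ring
  have hNpos : 0 < p * (p - 1) := Nat.mul_pos (by omega) (by omega)
  have hNR1 : (1 : ℝ) ≤ NR := by rw [hNRdef]; exact_mod_cast hNpos
  have hθp0 : 0 ≤ θp := by
    rw [hθpdef]; exact Real.log_nonneg (by exact_mod_cast primorial_pos p)
  -- the slack `σ`, the exponent `a`, the density exponent `c`
  obtain ⟨σ, hσ, hσν⟩ := exists_slackP (P := (p : ℝ)) (by linarith) hl hν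
  obtain ⟨a, hadef⟩ : ∃ a : ℝ, a = p * l + 2 * σ := ⟨_, rfl⟩
  have hpl : (1 : ℝ) ≤ (p : ℝ) * l := one_le_mul_of_one_le_of_one_le (by linarith) hl
  have ha0 : 0 < a := by rw [hadef]; linarith
  have hνa : ν * (a + 1) < 1 := by rw [hadef]; linarith
  obtain ⟨c, hcdef⟩ : ∃ c : ℝ, c = (max (ν * (a + 1)) 0 + 1) / 2 := ⟨_, rfl⟩
  have hmax1 : max (ν * (a + 1)) 0 < 1 := max_lt hνa one_pos
  have hc0 : 0 < c := by rw [hcdef]; have := le_max_right (ν * (a + 1)) 0; linarith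
  have hc1 : c < 1 := by rw [hcdef]; linarith
  have hνac : ν * (a + 1) < c := by
    rw [hcdef]; have := le_max_left (ν * (a + 1)) 0; linarith
  have hc₀ : 0 < Real.log (Real.log 3) := log_log_three_pos
  -- constants
  obtain ⟨KT, hKTdef⟩ : ∃ KT : ℝ, KT = 5 + 2 * Real.log (2 * NR) + 2 * NR := ⟨_, rfl⟩
  have hlog2N : 0 ≤ Real.log (2 * NR) := Real.log_nonneg (by linarith)
  have hKT5 : 5 ≤ KT := by rw [hKTdef]; linarith
  have hlogn : 0 ≤ Real.log nR := Real.log_nonneg hnR1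
  have hlog2K : 0 < Real.log (2 * KT) := Real.log_pos (by linarith)
  have hloghR : 0 < Real.log hR := by
    have h4 : (4 : ℝ) ≤ hR := by rw [hhRdef]; exact_mod_cast four_le_masserH hp
    exact Real.log_pos (by linarith)
  have hlog2 : 0 < Real.log 2 := Real.log_pos (by norm_num)
  obtain ⟨A, hAdef⟩ : ∃ A : ℝ, A = nR * Real.log nR + nR * Real.log (2 * KT) + e * Real.log hR +
      nR * (a + 2) + e * NR := ⟨_, rfl⟩
  have hA : 0 < A := by rw [hAdef]; positivity
  obtain ⟨J, hJdef⟩ : ∃ J : ℝ, J = Real.log C + (Real.log 3 ^ ν + 1) / Real.log (Real.log 3) +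
      nR * Real.log nR + nR * Real.log (2 * KT) + e * Real.log hR + e * Real.log 2 + 2 * e * Real.log 2 +
      l * nR * θp := ⟨_, rfl⟩
  obtain ⟨B, hBdef⟩ : ∃ B : ℝ, B = nR * (a + 2) + 2 * e := ⟨_, rfl⟩
  -- Chebyshev for `T`, and the error bound `Err(y) ≤ e σ y^c` eventually
  obtain ⟨T₀, hT₀⟩ := eventually_theta_ge_half
  have hF := (isLittleO_errorFun' (J := J) (B := B) (ν := ν) (c₀ := Real.log (Real.log 3)) hA
    (by linarith) hνac hc0).def (show (0 : ℝ) < e * σ by positivity)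
  rw [Filter.eventually_atTop] at hF
  obtain ⟨y₁, hy₁⟩ := hF
  -- the parameter `Y` (Dirichlet)
  obtain ⟨Y, hYy₀, hYk⟩ := exists_card_primesModEq_ge hgu hc0 hc1 one_pos
    (max (max T₀ 3) (Nat.ceil (max y₁ 0)))
  rw [one_mul] at hYk
  have hY3 : 3 ≤ Y := le_trans (le_trans (le_max_right _ _) (le_max_left _ _)) hYy₀
  have hYT₀ : T₀ ≤ Y := le_trans (le_trans (le_max_left _ _) (le_max_left _ _)) hYy₀
  have hYy₁ : y₁ ≤ (Y : ℝ) := by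
    calc y₁ ≤ max y₁ 0 := le_max_left _ _
      _ ≤ (Nat.ceil (max y₁ 0) : ℝ) := Nat.le_ceil _
      _ ≤ (Y : ℝ) := by exact_mod_cast le_trans (le_max_right _ _) hYy₀
  have hYR : (3 : ℝ) ≤ Y := by exact_mod_cast hY3
  have hY1 : (1 : ℝ) ≤ Y := by linarith
  have hY0 : (0 : ℝ) < Y := by linarith
  have hlogY1 : 1 ≤ Real.log Y := by
    rw [Real.le_log_iff_exp_le hY0]
    have := Real.exp_one_lt_d9; linarith
  have hlogY0 : 0 < Real.log Y := by linarith
  have hYa1 : (1 : ℝ) ≤ (Y : ℝ) ^ a := Real.one_le_rpow hY1 ha0.le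
  have hYc1 : (1 : ℝ) ≤ (Y : ℝ) ^ c := Real.one_le_rpow hY1 hc0.le
  set k : ℕ := (primesModEq p g Y).card with hkdef
  have hk1R : (1 : ℝ) ≤ k := le_trans hYc1 hYk
  have hk1 : 1 ≤ k := by exact_mod_cast hk1R
  -- the parameter `E`
  obtain ⟨E, hEdef⟩ : ∃ E : ℕ, E = Nat.floor ((Y : ℝ) ^ a) := ⟨_, rfl⟩
  have hE1 : 1 ≤ E := hEdef ▸ Nat.le_floor (by simpa using hYa1)
  have hEle : (E : ℝ) ≤ (Y : ℝ) ^ a := hEdef ▸ Nat.floor_le (by positivity)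
  have hElt : (Y : ℝ) ^ a < (E : ℝ) + 1 := hEdef ▸ Nat.lt_floor_add_one _
  -- the parameter `T`
  obtain ⟨X, hXdef⟩ : ∃ X : ℝ, X = Real.log (2 * NR) + NR * ((Y : ℝ) * E * Real.log Y) := ⟨_, rfl⟩
  have hX0 : 0 ≤ X := by rw [hXdef]; positivity
  obtain ⟨T, hTdef⟩ : ∃ T : ℕ, T = max T₀ (Nat.ceil (2 * X) + 1) := ⟨_, rfl⟩
  have hTT₀ : T₀ ≤ T := hTdef ▸ le_max_left _ _
  have hTX : 2 * X + 1 ≤ (T : ℝ) := by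
    have h1 : ((Nat.ceil (2 * X) + 1 : ℕ) : ℝ) ≤ (T : ℝ) := by
      rw [hTdef]; exact_mod_cast le_max_right _ _
    push_cast at h1
    linarith [Nat.le_ceil (2 * X)]
  have hT : X < θ (T : ℝ) := by
    have := hT₀ T hTT₀
    linarith
  refine ⟨Y, E, T, by omega, hE1, hk1, by rw [← hXdef]; exact hT, ?_⟩
  -- facts for `hneed`
  have f3 : a * Real.log Y ≤ Real.log ((E : ℝ) + 1) := by
    rw [← Real.log_rpow hY0]
    exact Real.log_le_log (by positivity) hElt.le
  -- `T ≤ KT Y^(a+2)`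
  have hYpow : (Y : ℝ) ≤ (Y : ℝ) ^ (a + 2) := by
    calc (Y : ℝ) = (Y : ℝ) ^ (1 : ℝ) := (Real.rpow_one _).symm
      _ ≤ (Y : ℝ) ^ (a + 2) := Real.rpow_le_rpow_of_exponent_le hY1 (by linarith)
  have hYEa2 : (Y : ℝ) * E * Real.log Y ≤ (Y : ℝ) ^ (a + 2) := by
    have hlogYY : Real.log Y ≤ (Y : ℝ) := Real.log_le_self hY0.le
    calc (Y : ℝ) * E * Real.log Y ≤ (Y : ℝ) * (Y : ℝ) ^ a * Y := by
          apply mul_le_mul (mul_le_mul_of_nonneg_left hEle hY0.le) hlogYY hlogY0.le (by positivity)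
      _ = (Y : ℝ) ^ (a + 2) := by
          rw [show a + 2 = 1 + a + 1 by ring, Real.rpow_add hY0 (1 + a) 1, Real.rpow_add hY0 1 a,
            Real.rpow_one]
  have h6 : (1 : ℝ) ≤ (Y : ℝ) ^ (a + 2) := le_trans hY1 hYpow
  have hTK : (T : ℝ) ≤ KT * (Y : ℝ) ^ (a + 2) := by
    have h1 : (T : ℝ) ≤ T₀ + (Nat.ceil (2 * X) + 1 : ℕ) := by
      rw [hTdef]; exact_mod_cast max_le_add_of_nonneg (Nat.zero_le _) (Nat.zero_le _)
    have h2 : ((Nat.ceil (2 * X) + 1 : ℕ) : ℝ) ≤ 2 * X + 2 := by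
      push_cast; linarith [Nat.ceil_lt_add_one (show 0 ≤ 2 * X by positivity)]
    have h3 : (T₀ : ℝ) ≤ Y := by exact_mod_cast hYT₀
    have hXle : X ≤ Real.log (2 * NR) + NR * (Y : ℝ) ^ (a + 2) := by
      have := mul_le_mul_of_nonneg_left hYEa2 (show (0 : ℝ) ≤ NR by linarith)
      rw [hXdef]; linarith
    have h4 : Real.log (2 * NR) ≤ Real.log (2 * NR) * (Y : ℝ) ^ (a + 2) :=
      le_mul_of_one_le_right hlog2N h6
    have hexp : KT * (Y : ℝ) ^ (a + 2) = 5 * (Y : ℝ) ^ (a + 2) +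
        2 * (Real.log (2 * NR) * (Y : ℝ) ^ (a + 2)) + 2 * (NR * (Y : ℝ) ^ (a + 2)) := by
      rw [hKTdef]; ring
    rw [hexp]
    linarith
  have hT1 : (1 : ℝ) ≤ T := by linarith
  obtain ⟨hlog2T, hΛ1, hΛle⟩ := param_boundsP (e := e) hp he ha0 hKT5 hY3 hEle hTK hT1
  rw [← hAdef] at hΛle
  have hΛν : (nR * Real.log nR + nR * Real.log (2 * (T : ℝ)) + e * Real.log hR +
      e * NR * ((Y : ℝ) * E * Real.log Y)) ^ ν ≤ 1 + (A * (Y : ℝ) ^ (a + 1) * Real.log Y) ^ ν := by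
    have hpos : 0 ≤ (A * (Y : ℝ) ^ (a + 1) * Real.log Y) ^ ν := Real.rpow_nonneg (by positivity) ν
    rcases le_or_gt 0 ν with hν0 | hν0
    · have := Real.rpow_le_rpow (by linarith) hΛle hν0
      linarith
    · have := Real.rpow_le_one_of_one_le_of_nonpos hΛ1 hν0.le
      linarith
  -- the error bound at `Y`
  have hFY := hy₁ Y hYy₁
  rw [Real.norm_of_nonneg (Real.rpow_nonneg hY0.le c), Real.norm_eq_abs] at hFY
  have hFY' : J + B * Real.log Y + (A * (Y : ℝ) ^ (a + 1) * Real.log Y) ^ ν / Real.log (Real.log 3) ≤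
      e * σ * (Y : ℝ) ^ c := le_trans (le_abs_self _) hFY
  -- assemble `hneed`
  have hfracle : (Real.log 3 ^ ν + (nR * Real.log nR + nR * Real.log (2 * (T : ℝ)) + e * Real.log hR +
      e * NR * ((Y : ℝ) * E * Real.log Y)) ^ ν) / Real.log (Real.log 3) ≤
      (Real.log 3 ^ ν + 1) / Real.log (Real.log 3) +
        (A * (Y : ℝ) ^ (a + 1) * Real.log Y) ^ ν / Real.log (Real.log 3) := by
    rw [← add_div]
    apply div_le_div_of_nonneg_right _ hc₀.le
    linarith
  have hlog2Y : Real.log (2 * (Y : ℝ)) = Real.log 2 + Real.log Y :=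
    Real.log_mul (by norm_num) hY0.ne'
  have hYc : (e : ℝ) * σ * (Y : ℝ) ^ c ≤ e * σ * k := mul_le_mul_of_nonneg_left hYk (by positivity)
  have hk1' : (e : ℝ) * σ * k < 2 * (e * σ) * (k * Real.log Y) := by
    have h1 : (e : ℝ) * σ * k ≤ (e * σ) * (k * Real.log Y) := by
      rw [← mul_assoc]
      exact le_mul_of_one_le_right (by positivity) hlogY1
    have h2 : 0 < (e : ℝ) * σ * k := by positivity
    linarith
  have hkE : (e : ℝ) * a * (k * Real.log Y) ≤ e * (k * Real.log ((E : ℝ) + 1)) := by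
    have h1 : (k : ℝ) * (a * Real.log Y) ≤ k * Real.log ((E : ℝ) + 1) :=
      mul_le_mul_of_nonneg_left f3 (by positivity)
    have := mul_le_mul_of_nonneg_left h1 (show (0 : ℝ) ≤ e by positivity)
    linarith
  have h2T : nR * Real.log (2 * (T : ℝ)) ≤ nR * (Real.log (2 * KT) + (a + 2) * Real.log Y) :=
    mul_le_mul_of_nonneg_left hlog2T (by positivity)
  exact prime_need_arith hnRpe hadef hJdef hBdef hlog2Y hfracle hFY' hYc hk1' hkE rfl h2T

/-- **Masser's theorem (`UniformABCDiscriminantSharp`) in every degree divisible by a prime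
`p ≥ 3`**, via the base field `ℚ[X]/(X^p − p v^{p-1} X + (p−1) u^p)` (irreducible by
`irreducible_or_exists_root`, or with an integer root), the smooth numbers built from primes
`≡ g (mod p)` for a generator `g` of `(ℤ/p)^×` (Dirichlet), and the base change `K ↦ K(r^{1/e})`,
`n = pe`. [cite: Masser2002, Theorem and §3] -/
theorem uniformABCDiscriminantSharp_prime_dvd {p : ℕ} (hprime : p.Prime) (hp3 : 3 ≤ p) :
    ∀ n : ℕ, 2 ≤ n → p ∣ n → ∀ l : ℝ, 1 ≤ l → ∀ ν : ℝ, ν < 1 / (l * n + 1) → ∀ C : ℝ,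
      ∃ (K : Type) (_ : Field K) (_ : NumberField K),
        Module.finrank ℚ K = n ∧
          ∃ a b c : K, a ≠ 0 ∧ b ≠ 0 ∧ c ≠ 0 ∧ a + b + c = 0 ∧
            C * |(NumberField.discr K : ℝ)| * masserPhi ν |(NumberField.discr K : ℝ)| *
                (masserSupport a b c : ℝ) ^ l <
              mulHeight ![a, b, c] := by
  intro n hn hpn l hl ν hν C
  obtain ⟨e, hpe⟩ := hpn
  have he : 1 ≤ e := by
    rcases Nat.eq_zero_or_pos e with h | h
    · rw [h, mul_zero] at hpe; omega
    · exact h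
  have hν' : ν < 1 / (p * l + 1) := by
    refine lt_of_lt_of_le hν ?_
    apply one_div_le_one_div_of_le (by positivity)
    have hpn' : (p : ℝ) ≤ n := by
      exact_mod_cast (show p ≤ n by rw [hpe]; exact Nat.le_mul_of_pos_right p he)
    nlinarith
  -- a generator of `(ℤ/p)^×`
  haveI : Fact p.Prime := ⟨hprime⟩
  obtain ⟨g₀, hg₀⟩ := IsCyclic.exists_generator (α := (ZMod p)ˣ)
  have hordg : orderOf g₀ = p - 1 := by
    rw [orderOf_eq_card_of_forall_mem_zpowers hg₀, Nat.card_eq_fintype_card, ZMod.card_units]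
  have hgu : IsUnit (g₀ : ZMod p) := g₀.isUnit
  have hg : ∀ f : ℕ, 0 < f → (g₀ : ZMod p) ^ f = 1 → p - 1 ≤ f := by
    intro f hf h1
    have h2 : g₀ ^ f = 1 := by
      apply Units.ext
      rw [Units.val_pow_eq_pow_val, Units.val_one]
      exact h1
    have h3 : orderOf g₀ ∣ f := orderOf_dvd_of_pow_eq_one h2
    rw [hordg] at h3
    exact Nat.le_of_dvd hf h3
  obtain ⟨Y, E, T, hY, hE, hk, hT, hneed⟩ := exists_good_params_prime hprime hp3 hgu he l ν C hl hν'
  obtain ⟨K, iF, iN, hfin, a, b, c, ha, hb, hc, habc, hlt⟩ :=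
    prime_assembly hprime hp3 hg he l ν C hl hY hE hk hT hneed
  exact ⟨K, iF, iN, hfin.trans hpe.symm, a, b, c, ha, hb, hc, habc, hlt⟩

/-- **Masser's theorem in every degree `n ≥ 2`.** Even degrees are
`uniformABCDiscriminantSharp_even` (base degree `2`, sibling file); an odd `n ≥ 3` has an odd prime
factor `p` and is covered by `uniformABCDiscriminantSharp_prime_dvd`.
[cite: Masser2002, Theorem and §2–§3] -/
theorem uniformABCDiscriminantSharp_all (n : ℕ) (hn : 2 ≤ n) (l : ℝ) (hl : 1 ≤ l) (ν : ℝ)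
    (hν : ν < 1 / (l * n + 1)) (C : ℝ) :
    ∃ (K : Type) (_ : Field K) (_ : NumberField K),
      Module.finrank ℚ K = n ∧
        ∃ a b c : K, a ≠ 0 ∧ b ≠ 0 ∧ c ≠ 0 ∧ a + b + c = 0 ∧
          C * |(NumberField.discr K : ℝ)| * masserPhi ν |(NumberField.discr K : ℝ)| *
              (masserSupport a b c : ℝ) ^ l <
            mulHeight ![a, b, c] := by
  by_cases h2 : 2 ∣ n
  · exact uniformABCDiscriminantSharp_even n hn (even_iff_two_dvd.mpr h2) l hl ν hν C
  · have hn1 : n ≠ 1 := by omega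
    have hprime : n.minFac.Prime := Nat.minFac_prime hn1
    have hdvd : n.minFac ∣ n := Nat.minFac_dvd n
    have h2' : n.minFac ≠ 2 := fun h => h2 (h ▸ hdvd)
    have hp3 : 3 ≤ n.minFac := by have := hprime.two_le; omega
    exact uniformABCDiscriminantSharp_prime_dvd hprime hp3 n hn hdvd l hl ν hν C

/-- **Discharge of the barrier fact**: Masser's theorem `UniformABCDiscriminantSharp` holds
(all `n ≥ 2`, `λ ≥ 1`, `ν < 1/(λn+1)`, `C`). [cite: Masser2002, Theorem] -/
theorem UniformABCDiscriminantSharp_holds : UniformABCDiscriminantSharp :=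
  fun n hn l hl ν hν C => uniformABCDiscriminantSharp_all n hn l hl ν hν C

end PrimeMain

end Literature.Barriers.ABC

end
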